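import Literature.NumberTheory.Automorphic.CDTTheorem712
import Literature.NumberTheory.EllipticCurves.ModFiveCongruenceHesseFamily
import Literature.NumberTheory.GaloisRepresentations.AbsGaloisGroup
import Literature.NumberTheory.EllipticCurves.ModFiveCongruenceHesseSyzygy
import Literature.NumberTheory.EllipticCurves.KleinQuinticSectionTable
import HarnessLib

/-!
# The `3`–`5` switch, part I: Klein's icosahedral descent — `Core1728` PROVED

For an elliptic curve `E : y² = x³ − 27c₄x − 54c₆` over `ℚ` with `c₆ ≠ 0` and a mod-`5` representation
`ρ̄ = ρ̄_{E,5}`, the twist-free `5`-congruent curves are the fibres of Klein's icosahedral cover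
`j = 1728·kC4³/(kC4³ − kC6²) : X(5) ≅ ℙ¹ → ℙ¹(j)`; `Core1728` (a `def … : Prop`, PROVED here as
`core1728_of_icosahedral_descent`) packages what the road needs from it: the members of the Hesse
family at `E` realise, up to the syzygy `ModFiveCongruenceHesseSyzygy.hesse5_syzygy`, every value of the
icosahedral parameter, with control of the bad primes.  Sections: Klein forms over a ring / a field /
an algebraically closed field (`§Klein`, `§KleinField`, `§KleinAlgClosed`), then the Galois descent
(`§Galois`, over `ℚ̄` with `Γ_ℚ = Field.absoluteGaloisGroup ℚ`).

Part II (`CDTThreeFiveSwitchProofs`) adds the order-`8` Frobenius certificate, Chebotarev at the twisted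
`1728`-fibre and Dirichlet, and assembles Wiles' `3`–`5` switch `BCDT.CDT_three_five_switch`.

Provenance: crux workfile `Summits/ABC/ABC/Cruxes/FreyModularity/STUB_IDEAS_stub_switch_3g10_Sketch.lean`
(= first half of `…_3g11_Road.lean`; farm rc 0, 0 sorry) with namespace ↦ `Literature.NumberTheory.Automorphic.CDTThreeFiveSwitch.Descent` and
`hesse_syzygy_F` taken by name from `ModFiveCongruenceHesseSyzygy`; no other change.  Revision r1 (review of
p844579): Klein's forms `kD`, `kC4`, `kC6` are IMPORTED from `KleinQuinticSectionTable` (namespace `KleinQuinticTorsion`)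
instead of being restated; `Core1728_holds` records the discharge of `Core1728` under the obligation-graph name;
the unused carrier `base` is dropped; no linter is disabled (two unused simp arguments removed instead).  Revision r2: the two section-local
notations of `§Galois` are spelled out (`AlgebraicClosure ℚ`, `Field.absoluteGaloisGroup ℚ`); no `notation` is declared.

## References
* [ConradDiamondTaylor1999] B. Conrad, F. Diamond, R. Taylor, JAMS 12 (1999), proof of Thm. 7.1.2 (p. 556).
* [Wiles1995] A. Wiles, Ann. of Math. 141 (1995), Ch. 5 (the `3`–`5` switch).
* [Fisher2012Hessian] T. Fisher, Proc. LMS 104 (2012), §8, Lemma 8.4, Thm 13.2.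
* F. Klein, Vorlesungen über das Ikosaeder (1884). [folklore]
-/


namespace Literature.NumberTheory.Automorphic.CDTThreeFiveSwitch.Descent

open _root_.Literature.NumberTheory.EllipticCurves _root_.Literature.NumberTheory.EllipticCurves.HesseFamilyFive
open _root_.Literature.NumberTheory.Automorphic _root_.Literature.NumberTheory.GaloisRepresentations
open _root_.Literature.NumberTheory.Automorphic.BCDT _root_.WeierstrassCurve
open _root_.Literature.NumberTheory.EllipticCurves.KleinQuinticTorsion (kD kC4 kC6)

/-! ## §0 Carriers (verbatim from k3-g4 / g8 / g9; Klein's forms `kD`, `kC4`, `kC6` are the PUBLIC ones of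
`KleinQuinticSectionTable`, opened by name above) -/

/-- **`Core1728` — the twisted `1728`-fibre of Klein's icosahedral cover has a good real point.**
For integers `c₄³ ≠ c₆²`, `c₆ ≠ 0` there are `τ ∈ Γ_ℚ` inverting `√−3` and fixing `μ₄`, and `t₁ ∈ ℚ̄` FIXED by `τ`,
with `𝔠₆(t₁, 1) = 0 ≠ 𝔠₄(t₁, 1)` for the degree-`5` Hesse polynomials at `(c₄, c₆)` — i.e. a member of the
`5`-congruence family of `E : y² = x³ − 27c₄x − 54c₆` with `j = 1728`, defined over a field in which `√−3` is
moved.  This is the road's form of the step "`X_E(5) ≅ ℙ¹` has points with prescribed local behaviour" of the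
`3`–`5` switch; PROVED below (`core1728_of_icosahedral_descent`) from Klein's invariant theory (the fixed points
of the icosahedral involutions are the edge midpoints `kC6 = 0`) and `√−3 ∉ ℚ(ζ₂₀)`. [cite: ConradDiamondTaylor1999, proof of Thm. 7.1.2 (p. 556)] -/
def Core1728 : Prop :=
  ∀ (c₄ c₆ : ℤ), c₄ ^ 3 ≠ c₆ ^ 2 → c₆ ≠ 0 →
    ∃ (τ : Field.absoluteGaloisGroup ℚ) (t₁ : AlgebraicClosure ℚ),
      (∀ s : AlgebraicClosure ℚ, s ^ 2 = -3 → τ • s = -s) ∧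
      (∀ z : AlgebraicClosure ℚ, z ^ 4 = 1 → τ • z = z) ∧
      C6 (c₄ : AlgebraicClosure ℚ) c₆ t₁ 1 = 0 ∧ C4 (c₄ : AlgebraicClosure ℚ) c₆ t₁ 1 ≠ 0 ∧
        τ • t₁ = t₁

/-- g8's pointwise CORE (verbatim). [folklore] -/
private def Core1728At (c₄ c₆ : ℤ) : Prop :=
  ∃ (τ : Field.absoluteGaloisGroup ℚ) (t₁ : AlgebraicClosure ℚ),
    (∀ s : AlgebraicClosure ℚ, s ^ 2 = -3 → τ • s = -s) ∧
    (∀ z : AlgebraicClosure ℚ, z ^ 4 = 1 → τ • z = z) ∧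
    C6 (c₄ : AlgebraicClosure ℚ) c₆ t₁ 1 = 0 ∧ C4 (c₄ : AlgebraicClosure ℚ) c₆ t₁ 1 ≠ 0 ∧ τ • t₁ = t₁

/-- `core1728_iff` — step of Klein's icosahedral descent for the `3`–`5` switch (see the module docstring). [folklore] -/
private theorem core1728_iff : Core1728 ↔ ∀ c₄ c₆ : ℤ, c₄ ^ 3 ≠ c₆ ^ 2 → c₆ ≠ 0 → Core1728At c₄ c₆ :=
  Iff.rfl

/-! ## §1 Klein's icosahedral forms (`kD`, `kC4`, `kC6` imported from `KleinQuinticSectionTable`; derivatives verbatim g9 §1) + the NEW first-order identities (PROVED) -/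

section Klein
variable {R : Type*} [CommRing R]

/-- `∂D/∂a`. [folklore] -/
private def kDa (a b : R) : R := 11 * a ^ 10 * b - 66 * a ^ 5 * b ^ 6 - b ^ 11
/-- `∂D/∂b`. [folklore] -/
private def kDb (a b : R) : R := a ^ 11 - 66 * a ^ 6 * b ^ 5 - 11 * a * b ^ 10
/-- NEW (g10): `∂c₄^{Kl}/∂a`, `∂c₄^{Kl}/∂b`. [folklore] -/
private def kC4a (a b : R) : R :=
  20 * a ^ 19 + 3420 * a ^ 14 * b ^ 5 + 4940 * a ^ 9 * b ^ 10 - 1140 * a ^ 4 * b ^ 15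
/-- `kC4b` — datum of Klein's icosahedral descent for the `3`–`5` switch (see the module docstring). [folklore] -/
private def kC4b (a b : R) : R :=
  1140 * a ^ 15 * b ^ 4 + 4940 * a ^ 10 * b ^ 9 - 3420 * a ^ 5 * b ^ 14 + 20 * b ^ 19
/-- Fisher's `M_v(λ,μ) = (λa − μ∂_bD, λb + μ∂_aD)` (Lemma 8.4), first and second coordinate. [folklore] -/
private def Mv1 (a b l m : R) : R := l * a - m * kDb a b
/-- `Mv2` — datum of Klein's icosahedral descent for the `3`–`5` switch (see the module docstring). [folklore] -/
private def Mv2 (a b l m : R) : R := l * b + m * kDa a b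

/-- `klein_euler` — step of Klein's icosahedral descent for the `3`–`5` switch (see the module docstring). [folklore] -/
private theorem klein_euler (a b : R) : a * kDa a b + b * kDb a b = 12 * kD a b := by
  simp only [kD, kDa, kDb]; ring

/-- NEW (PROVED): Euler for `c₄^{Kl}`. [folklore] -/
private theorem klein_euler_C4 (a b : R) : a * kC4a a b + b * kC4b a b = 20 * kC4 a b := by
  simp only [kC4, kC4a, kC4b]; ring

set_option maxHeartbeats 4000000 in
/-- NEW (PROVED; kit j345457 A1): Klein's `c₆^{Kl} = Jac(D, c₄^{Kl})/20`. [folklore] -/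
private theorem klein_jacobian (a b : R) :
    kDa a b * kC4b a b - kDb a b * kC4a a b = 20 * kC6 a b := by
  simp only [kDa, kDb, kC4a, kC4b, kC6]; ring

set_option maxHeartbeats 4000000 in
/-- `klein_syzygy` — step of Klein's icosahedral descent for the `3`–`5` switch (see the module docstring). [folklore] -/
private theorem klein_syzygy (a b : R) : kC4 a b ^ 3 - kC6 a b ^ 2 = 1728 * kD a b ^ 5 := by
  simp only [kD, kC4, kC6]; ring

/-- `kD_smul` — step of Klein's icosahedral descent for the `3`–`5` switch (see the module docstring). [folklore] -/
private theorem kD_smul (s a b : R) : kD (s * a) (s * b) = s ^ 12 * kD a b := by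
  simp only [kD]; ring
/-- `kC4_smul` — step of Klein's icosahedral descent for the `3`–`5` switch (see the module docstring). [folklore] -/
private theorem kC4_smul (s a b : R) : kC4 (s * a) (s * b) = s ^ 20 * kC4 a b := by
  simp only [kC4]; ring
/-- `kC6_smul` — step of Klein's icosahedral descent for the `3`–`5` switch (see the module docstring). [folklore] -/
private theorem kC6_smul (s a b : R) : kC6 (s * a) (s * b) = s ^ 30 * kC6 a b := by
  simp only [kC6]; ring

/-- The edge midpoint `(i : 1)`. [folklore] -/
private theorem kC6_I (i : R) (hi : i ^ 2 = -1) : kC6 i 1 = 0 := by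
  have e5 : i ^ 5 = i := by rw [show i ^ 5 = (i ^ 2) ^ 2 * i by ring, hi]; ring
  have e10 : i ^ 10 = -1 := by rw [show i ^ 10 = (i ^ 2) ^ 5 by ring, hi]; ring
  have e20 : i ^ 20 = 1 := by rw [show i ^ 20 = (i ^ 2) ^ 10 by ring, hi]; ring
  have e25 : i ^ 25 = i := by rw [show i ^ 25 = (i ^ 2) ^ 12 * i by ring, hi]; ring
  have e30 : i ^ 30 = -1 := by rw [show i ^ 30 = (i ^ 2) ^ 15 by ring, hi]; ring
  simp only [kC6]
  linear_combination (-1 : R) * e30 + 522 * e25 + 10005 * e20 + 10005 * e10 - 522 * e5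

/-- NEW (PROVED): the Klein forms commute with ring homomorphisms. [folklore] -/
private theorem map_kC4 {S : Type*} [CommRing S] (f : R →+* S) (a b : R) :
    f (kC4 a b) = kC4 (f a) (f b) := by
  simp only [kC4, map_add, map_sub, map_mul, map_pow, map_ofNat]

/-- `map_kD` — step of Klein's icosahedral descent for the `3`–`5` switch (see the module docstring). [folklore] -/
private theorem map_kD {S : Type*} [CommRing S] (f : R →+* S) (a b : R) :
    f (kD a b) = kD (f a) (f b) := by
  simp only [kD, map_sub, map_mul, map_pow, map_ofNat]

/-- `map_kC6` — step of Klein's icosahedral descent for the `3`–`5` switch (see the module docstring). [folklore] -/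
private theorem map_kC6 {S : Type*} [CommRing S] (f : R →+* S) (a b : R) :
    f (kC6 a b) = kC6 (f a) (f b) := by
  simp only [kC6, map_add, map_sub, map_neg, map_mul, map_pow, map_ofNat]

open _root_.Polynomial in
/-- NEW (PROVED): the derivative at `0` of `t ↦ c₄^{Kl}(x + tu, y + tw)` is `∇c₄^{Kl}(x,y)·(u,w)`. [folklore] -/
private theorem lineDeriv_kC4 (x y u w : R) :
    (derivative (kC4 (C x + C u * X) (C y + C w * X))).eval 0 = kC4a x y * u + kC4b x y * w := by
  simp [kC4, kC4a, kC4b, derivative_mul, derivative_pow]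
  ring

open _root_.Polynomial in
/-- `lineDeriv_kD` — step of Klein's icosahedral descent for the `3`–`5` switch (see the module docstring). [folklore] -/
private theorem lineDeriv_kD (x y u w : R) :
    (derivative (kD (C x + C u * X) (C y + C w * X))).eval 0 = kDa x y * u + kDb x y * w := by
  simp [kD, kDa, kDb, derivative_mul, derivative_pow]
  ring

end Klein

section KleinField
variable {F : Type*} [Field F]

/-- `kC4_I_ne` — step of Klein's icosahedral descent for the `3`–`5` switch (see the module docstring). [folklore] -/
private theorem kC4_I_ne [CharZero F] (i : F) (hi : i ^ 2 = -1) : kC4 i 1 ≠ 0 := by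
  have e5 : i ^ 5 = i := by rw [show i ^ 5 = (i ^ 2) ^ 2 * i by ring, hi]; ring
  have e10 : i ^ 10 = -1 := by rw [show i ^ 10 = (i ^ 2) ^ 5 by ring, hi]; ring
  have e15 : i ^ 15 = -i := by rw [show i ^ 15 = (i ^ 2) ^ 7 * i by ring, hi]; ring
  have e20 : i ^ 20 = 1 := by rw [show i ^ 20 = (i ^ 2) ^ 10 by ring, hi]; ring
  intro h
  simp only [kC4] at h
  have key : (456 : F) * i = -492 := by
    linear_combination -h + e20 + 228 * e15 + 494 * e10 - 228 * e5
  have h2 : (456 : F) ^ 2 * i ^ 2 = (-492) ^ 2 := by rw [← mul_pow, key]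
  rw [hi] at h2
  norm_num at h2

/-- `kD_ne_zero_of_ne` — step of Klein's icosahedral descent for the `3`–`5` switch (see the module docstring). [folklore] -/
private theorem kD_ne_zero_of_ne (a b : F) (h : kC4 a b ^ 3 ≠ kC6 a b ^ 2) : kD a b ≠ 0 := by
  intro hD
  apply h
  have := klein_syzygy a b
  rw [hD] at this
  exact sub_eq_zero.mp (by simpa using this)

/-- `edge_nondeg` — step of Klein's icosahedral descent for the `3`–`5` switch (see the module docstring). [folklore] -/
private theorem edge_nondeg (a b e₁ e₂ : F) (he6 : kC6 e₁ e₂ = 0) (he4 : kC4 e₁ e₂ ≠ 0)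
    (h6 : kC6 a b ≠ 0) : e₂ * a - e₁ * b ≠ 0 := by
  intro h
  have hab : e₂ * a = e₁ * b := sub_eq_zero.mp h
  by_cases he2 : e₂ = 0
  · subst he2
    have he1 : e₁ ≠ 0 := by rintro rfl; exact he4 (by simp [kC4])
    have hb : b = 0 := by
      rcases mul_eq_zero.mp (show e₁ * b = 0 by rw [← hab]; ring) with h | h
      · exact absurd h he1
      · exact h
    subst hb
    have h60 : kC6 e₁ (0 : F) = -e₁ ^ 30 := by simp [kC6]
    rw [h60, neg_eq_zero] at he6
    exact he1 (pow_eq_zero_iff (by norm_num) |>.mp he6)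
  · have key : e₂ ^ 30 * kC6 a b = b ^ 30 * kC6 e₁ e₂ := by
      rw [← kC6_smul, ← kC6_smul, hab, mul_comm e₂ b, mul_comm e₁ b]
    rw [he6, mul_zero] at key
    rcases mul_eq_zero.mp key with h' | h'
    · exact he2 (pow_eq_zero_iff (by norm_num) |>.mp h')
    · exact h6 h'

/-! ## §2 Lemma 8.4 and the good root (PROVED in g9; proofs reproduced verbatim — crux workfiles do not import) -/

set_option maxHeartbeats 40000000 in
/-- **L84-D (PROVED g9, `ring` ≈ 20 s; verbatim).** [Fisher2012Hessian Lemma 8.4 p.12] [folklore] -/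
private theorem lemma84_D (a b l m : F) :
    D (kC4 a b) (kC6 a b) l m * kD a b = kD (Mv1 a b l m) (Mv2 a b l m) := by
  simp only [D, kC4, kC6, kD, Mv1, Mv2, kDa, kDb]
  ring

/-- second partials of Klein's `D` (g9). [folklore] -/
private def kDaa (a b : F) : F := 110 * a ^ 9 * b - 330 * a ^ 4 * b ^ 6
/-- `kDab` — datum of Klein's icosahedral descent for the `3`–`5` switch (see the module docstring). [folklore] -/
private def kDab (a b : F) : F := 11 * a ^ 10 - 396 * a ^ 5 * b ^ 5 - 11 * b ^ 10
/-- `kDbb` — datum of Klein's icosahedral descent for the `3`–`5` switch (see the module docstring). [folklore] -/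
private def kDbb (a b : F) : F := -330 * a ^ 6 * b ^ 4 - 110 * a * b ^ 9

/-- Klein: `Hess(D) = −121·c₄^{Kl}` (g9; kit j345457 A3). [folklore] -/
private theorem klein_hessian (a b : F) : kDaa a b * kDbb a b - kDab a b ^ 2 = -121 * kC4 a b := by
  simp only [kDaa, kDab, kDbb, kC4]; ring

set_option maxHeartbeats 40000000 in
/-- `∂²/∂λ²` of L84-D (g9, verbatim). [folklore] -/
private theorem chain_ll (a b l m : F) :
    Dll (kC4 a b) (kC6 a b) l m * kD a b =
      a ^ 2 * kDaa (Mv1 a b l m) (Mv2 a b l m) + 2 * a * b * kDab (Mv1 a b l m) (Mv2 a b l m)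
        + b ^ 2 * kDbb (Mv1 a b l m) (Mv2 a b l m) := by
  simp only [Dll, kC4, kC6, kD, kDaa, kDab, kDbb, Mv1, Mv2, kDa, kDb]; ring

set_option maxHeartbeats 40000000 in
/-- `∂²/∂λ∂μ` of L84-D (g9, verbatim). [folklore] -/
private theorem chain_lm (a b l m : F) :
    Dlm (kC4 a b) (kC6 a b) l m * kD a b =
      -(a * kDb a b) * kDaa (Mv1 a b l m) (Mv2 a b l m)
        + (a * kDa a b - b * kDb a b) * kDab (Mv1 a b l m) (Mv2 a b l m)
        + b * kDa a b * kDbb (Mv1 a b l m) (Mv2 a b l m) := by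
  simp only [Dlm, kC4, kC6, kD, kDaa, kDab, kDbb, Mv1, Mv2, kDa, kDb]; ring

set_option maxHeartbeats 40000000 in
/-- `∂²/∂μ²` of L84-D (g9, verbatim). [folklore] -/
private theorem chain_mm (a b l m : F) :
    Dmm (kC4 a b) (kC6 a b) l m * kD a b =
      kDb a b ^ 2 * kDaa (Mv1 a b l m) (Mv2 a b l m)
        - 2 * kDa a b * kDb a b * kDab (Mv1 a b l m) (Mv2 a b l m)
        + kDa a b ^ 2 * kDbb (Mv1 a b l m) (Mv2 a b l m) := by
  simp only [Dmm, kC4, kC6, kD, kDaa, kDab, kDbb, Mv1, Mv2, kDa, kDb]; ring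

/-- **L84-C4 (PROVED g9 via the Hessian chain rule; verbatim).** [Fisher2012Hessian Lemma 8.4] [folklore] -/
private theorem lemma84_C4 [CharZero F] (a b l m : F) (hD : kD a b ≠ 0) :
    C4 (kC4 a b) (kC6 a b) l m = kC4 (Mv1 a b l m) (Mv2 a b l m) := by
  have hll := chain_ll a b l m
  have hlm := chain_lm a b l m
  have hmm := chain_mm a b l m
  have heul := klein_euler a b
  have hhess := klein_hessian (Mv1 a b l m) (Mv2 a b l m)
  have hk2 : kD a b ^ 2 ≠ 0 := pow_ne_zero _ hD
  have h2 : Dll (kC4 a b) (kC6 a b) l m * Dmm (kC4 a b) (kC6 a b) l m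
      - Dlm (kC4 a b) (kC6 a b) l m ^ 2 = -17424 * kC4 (Mv1 a b l m) (Mv2 a b l m) := by
    apply mul_right_cancel₀ hk2
    linear_combination (Dmm (kC4 a b) (kC6 a b) l m * kD a b) * hll
      + (a ^ 2 * kDaa (Mv1 a b l m) (Mv2 a b l m) + 2 * a * b * kDab (Mv1 a b l m) (Mv2 a b l m)
          + b ^ 2 * kDbb (Mv1 a b l m) (Mv2 a b l m)) * hmm
      - (Dlm (kC4 a b) (kC6 a b) l m * kD a b
          + (-(a * kDb a b) * kDaa (Mv1 a b l m) (Mv2 a b l m)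
            + (a * kDa a b - b * kDb a b) * kDab (Mv1 a b l m) (Mv2 a b l m)
            + b * kDa a b * kDbb (Mv1 a b l m) (Mv2 a b l m))) * hlm
      + ((kDaa (Mv1 a b l m) (Mv2 a b l m) * kDbb (Mv1 a b l m) (Mv2 a b l m)
          - kDab (Mv1 a b l m) (Mv2 a b l m) ^ 2) * (a * kDa a b + b * kDb a b + 12 * kD a b)) * heul
      + (144 * kD a b ^ 2) * hhess
  rw [C4, h2]
  field_simp

/-- Fisher's syzygy at `μ = 1` — BY NAME from the memory-light certified module
`ModFiveCongruenceHesseSyzygy` (the one-shot `field_simp; ring` proof is not replayed here).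
[cite: Fisher2012Hessian, §8, formula (8.1), n = 5] -/
private theorem hesse_syzygy_F [CharZero F] (c₄ c₆ l : F) :
    C4 c₄ c₆ l 1 ^ 3 - C6 c₄ c₆ l 1 ^ 2 = (c₄ ^ 3 - c₆ ^ 2) * D c₄ c₆ l 1 ^ 5 :=
  Literature.NumberTheory.EllipticCurves.HesseSyzygyFive.hesse5_syzygy c₄ c₆ l 1

/-- `t_e(v) = M_v⁻¹(e)` (g9). [folklore] -/
private def tE (a b e₁ e₂ : F) : F := (e₂ * kDb a b + e₁ * kDa a b) / (e₂ * a - e₁ * b)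

/-- `M_v(t_e(v), 1) ∝ e` (PROVED, g9). [folklore] -/
private theorem Mv_at_tE (a b e₁ e₂ : F) (hne : e₂ * a - e₁ * b ≠ 0) :
    Mv1 a b (tE a b e₁ e₂) 1 = e₁ * (12 * kD a b) / (e₂ * a - e₁ * b) ∧
      Mv2 a b (tE a b e₁ e₂) 1 = e₂ * (12 * kD a b) / (e₂ * a - e₁ * b) := by
  constructor
  · simp only [Mv1, tE]
    have h : (e₂ * kDb a b + e₁ * kDa a b) / (e₂ * a - e₁ * b) * a - 1 * kDb a b =
        e₁ * (a * kDa a b + b * kDb a b) / (e₂ * a - e₁ * b) := by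
      field_simp
      ring
    rw [h, klein_euler]
  · simp only [Mv2, tE]
    have h : (e₂ * kDb a b + e₁ * kDa a b) / (e₂ * a - e₁ * b) * b + 1 * kDa a b =
        e₂ * (a * kDa a b + b * kDb a b) / (e₂ * a - e₁ * b) := by
      field_simp
      ring
    rw [h, klein_euler]

/-- **H-ROOT (PROVED g9 from L84-D, L84-C4 and the two syzygies; copy verbatim):** `t_e(v)` is a
GOOD root of `𝔠₆` for every edge midpoint `e` not proportional to the torsor point `v`. [folklore] -/
private theorem goodRoot_tE [CharZero F] (a b e₁ e₂ : F) (he6 : kC6 e₁ e₂ = 0) (he4 : kC4 e₁ e₂ ≠ 0)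
    (hD : kD a b ≠ 0) (hne : e₂ * a - e₁ * b ≠ 0) :
    C6 (kC4 a b) (kC6 a b) (tE a b e₁ e₂) 1 = 0 ∧
      C4 (kC4 a b) (kC6 a b) (tE a b e₁ e₂) 1 ≠ 0 := by
  obtain ⟨h1, h2⟩ := Mv_at_tE a b e₁ e₂ hne
  set s : F := 12 * kD a b / (e₂ * a - e₁ * b) with hs_def
  have hs : s ≠ 0 := div_ne_zero (mul_ne_zero (by norm_num) hD) hne
  have hM1 : Mv1 a b (tE a b e₁ e₂) 1 = s * e₁ := by rw [h1, hs_def]; ring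
  have hM2 : Mv2 a b (tE a b e₁ e₂) 1 = s * e₂ := by rw [h2, hs_def]; ring
  have h4 : C4 (kC4 a b) (kC6 a b) (tE a b e₁ e₂) 1 = s ^ 20 * kC4 e₁ e₂ := by
    rw [lemma84_C4 a b _ _ hD, hM1, hM2, kC4_smul]
  have hDD : D (kC4 a b) (kC6 a b) (tE a b e₁ e₂) 1 * kD a b = s ^ 12 * kD e₁ e₂ := by
    rw [lemma84_D, hM1, hM2, kD_smul]
  refine ⟨?_, by rw [h4]; exact mul_ne_zero (pow_ne_zero _ hs) he4⟩
  have hsyz := hesse_syzygy_F (kC4 a b) (kC6 a b) (tE a b e₁ e₂)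
  have hK := klein_syzygy a b
  have hKe := klein_syzygy e₁ e₂
  have hsq : C6 (kC4 a b) (kC6 a b) (tE a b e₁ e₂) 1 ^ 2 = 0 := by
    calc C6 (kC4 a b) (kC6 a b) (tE a b e₁ e₂) 1 ^ 2
        = C4 (kC4 a b) (kC6 a b) (tE a b e₁ e₂) 1 ^ 3
            - (kC4 a b ^ 3 - kC6 a b ^ 2) * D (kC4 a b) (kC6 a b) (tE a b e₁ e₂) 1 ^ 5 := by
          linear_combination (-1 : F) * hsyz
      _ = (s ^ 20 * kC4 e₁ e₂) ^ 3
            - 1728 * (D (kC4 a b) (kC6 a b) (tE a b e₁ e₂) 1 * kD a b) ^ 5 := by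
          rw [h4, hK]; ring
      _ = (s ^ 20 * kC4 e₁ e₂) ^ 3 - 1728 * (s ^ 12 * kD e₁ e₂) ^ 5 := by rw [hDD]
      _ = 0 := by linear_combination (s ^ 60) * hKe + (s ^ 60 * kC6 e₁ e₂) * he6
  exact pow_eq_zero_iff (by norm_num) |>.mp hsq

/-! ## §3 NEW (g10): the transition matrix `g = M_{v'} M_v⁻¹` and its invariants -/

/-- `M_v` as a matrix (columns `v` and `(−∂_bD(v), ∂_aD(v))`); `det = 12 D(v)` (Euler). [folklore] -/
private def Mv (a b : F) : Matrix (Fin 2) (Fin 2) F := !![a, -kDb a b; b, kDa a b]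

/-- `Mv_det` — step of Klein's icosahedral descent for the `3`–`5` switch (see the module docstring). [folklore] -/
private theorem Mv_det (a b : F) : (Mv a b).det = 12 * kD a b := by
  rw [Mv, Matrix.det_fin_two_of]
  linear_combination klein_euler a b

/-- apply a `2 × 2` matrix to `(x, y)`. [folklore] -/
private def ap (g : Matrix (Fin 2) (Fin 2) F) (x y : F) : F × F :=
  (g 0 0 * x + g 0 1 * y, g 1 0 * x + g 1 1 * y)

/-- `ap_Mv` — step of Klein's icosahedral descent for the `3`–`5` switch (see the module docstring). [folklore] -/
private theorem ap_Mv (a b l m : F) : ap (Mv a b) l m = (Mv1 a b l m, Mv2 a b l m) := by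
  refine Prod.ext ?_ ?_ <;> simp [ap, Mv, Mv1, Mv2] <;> ring

/-- `ap_mul` — step of Klein's icosahedral descent for the `3`–`5` switch (see the module docstring). [folklore] -/
private theorem ap_mul (g h : Matrix (Fin 2) (Fin 2) F) (x y : F) :
    ap (g * h) x y = ap g (ap h x y).1 (ap h x y).2 := by
  simp only [ap, Matrix.mul_apply, Fin.sum_univ_two]
  refine Prod.ext ?_ ?_ <;> dsimp only <;> ring

/-- `ap_smul` — step of Klein's icosahedral descent for the `3`–`5` switch (see the module docstring). [folklore] -/
private theorem ap_smul (l : F) (g : Matrix (Fin 2) (Fin 2) F) (x y : F) :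
    ap (l • g) x y = (l * (ap g x y).1, l * (ap g x y).2) := by
  simp only [ap, Matrix.smul_apply, smul_eq_mul]
  refine Prod.ext ?_ ?_ <;> dsimp only <;> ring

/-- `ap_one` — step of Klein's icosahedral descent for the `3`–`5` switch (see the module docstring). [folklore] -/
private theorem ap_one (x y : F) : ap (1 : Matrix (Fin 2) (Fin 2) F) x y = (x, y) := by
  simp [ap]

/-- eigenvectors pass to powers. [folklore] -/
private theorem ap_pow_of_eigen (g : Matrix (Fin 2) (Fin 2) F) (x y ν : F) (h : ap g x y = (ν * x, ν * y))
    (k : ℕ) : ap (g ^ k) x y = (ν ^ k * x, ν ^ k * y) := by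
  induction k with
  | zero => simp [ap_one]
  | succ k ih =>
    have h1 := congrArg Prod.fst h
    have h2 := congrArg Prod.snd h
    simp only [ap] at h1 h2
    rw [pow_succ', ap_mul, ih]
    simp only [ap]
    refine Prod.ext ?_ ?_ <;> dsimp only
    · linear_combination (ν ^ k) * h1
    · linear_combination (ν ^ k) * h2

/-- an invertible matrix has no eigenvalue `0` on a nonzero vector. [folklore] -/
private theorem eigen_ne_zero (g : Matrix (Fin 2) (Fin 2) F) (hg : g.det ≠ 0) (x y ν : F)
    (h0 : (x, y) ≠ (0, 0)) (h : ap g x y = (ν * x, ν * y)) : ν ≠ 0 := by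
  rintro rfl
  have h1 := congrArg Prod.fst h
  have h2 := congrArg Prod.snd h
  simp only [ap, zero_mul] at h1 h2
  rw [Matrix.det_fin_two] at hg
  apply h0
  have hx : (g 0 0 * g 1 1 - g 0 1 * g 1 0) * x = 0 := by
    linear_combination (g 1 1) * h1 - (g 0 1) * h2
  have hy : (g 0 0 * g 1 1 - g 0 1 * g 1 0) * y = 0 := by
    linear_combination (g 0 0) * h2 - (g 1 0) * h1
  rw [mul_eq_zero] at hx hy
  rw [Prod.mk.injEq]
  exact ⟨hx.resolve_left hg, hy.resolve_left hg⟩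

/-- The transition matrix between two torsor points. [folklore] -/
private noncomputable def Gm (a b a' b' : F) : Matrix (Fin 2) (Fin 2) F := Mv a' b' * (Mv a b)⁻¹

/-- `Gm_mul_Mv` — step of Klein's icosahedral descent for the `3`–`5` switch (see the module docstring). [folklore] -/
private theorem Gm_mul_Mv [CharZero F] (a b a' b' : F) (hD : kD a b ≠ 0) : Gm a b a' b' * Mv a b = Mv a' b' := by
  have hu : IsUnit (Mv a b).det := by
    rw [Mv_det]; exact isUnit_iff_ne_zero.mpr (mul_ne_zero (by norm_num) hD)
  rw [Gm, Matrix.mul_assoc, Matrix.nonsing_inv_mul _ hu, Matrix.mul_one]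

/-- `Gm_self` — step of Klein's icosahedral descent for the `3`–`5` switch (see the module docstring). [folklore] -/
private theorem Gm_self [CharZero F] (a b : F) (hD : kD a b ≠ 0) : Gm a b a b = 1 := by
  have hu : IsUnit (Mv a b).det := by
    rw [Mv_det]; exact isUnit_iff_ne_zero.mpr (mul_ne_zero (by norm_num) hD)
  rw [Gm, Matrix.mul_nonsing_inv _ hu]

/-- `Gm_det_ne` — step of Klein's icosahedral descent for the `3`–`5` switch (see the module docstring). [folklore] -/
private theorem Gm_det_ne [CharZero F] (a b a' b' : F) (hD : kD a b ≠ 0) (hD' : kD a' b' ≠ 0) :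
    (Gm a b a' b').det ≠ 0 := by
  intro h
  have := congrArg Matrix.det (Gm_mul_Mv a b a' b' hD)
  rw [Matrix.det_mul, h, zero_mul, Mv_det] at this
  exact mul_ne_zero (by norm_num) hD' this.symm

/-- `Gm = l • 1` means `M_{v'} = l • M_v`. [folklore] -/
private theorem Mv_eq_smul_of_Gm [CharZero F] (a b a' b' l : F) (hD : kD a b ≠ 0) (h : Gm a b a' b' = l • 1) :
    Mv a' b' = l • Mv a b := by
  rw [← Gm_mul_Mv a b a' b' hD, h, Matrix.smul_mul, Matrix.one_mul]

/-- `t_e` only depends on `[M_v]`: proportional `M`'s give the same `t_e`. [folklore] -/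
private theorem tE_eq_of_Mv_smul (a b a' b' l : F) (hl : l ≠ 0) (h : Mv a' b' = l • Mv a b) (e₁ e₂ : F) :
    tE a' b' e₁ e₂ = tE a b e₁ e₂ := by
  have e00 : a' = l * a := by simpa [Mv] using congrFun (congrFun h 0) 0
  have e10 : b' = l * b := by simpa [Mv] using congrFun (congrFun h 1) 0
  have e01 : kDb a' b' = l * kDb a b := by
    have := congrFun (congrFun h 0) 1
    simp [Mv] at this
    linear_combination this
  have e11 : kDa a' b' = l * kDa a b := by simpa [Mv] using congrFun (congrFun h 1) 1
  simp only [tE]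
  rw [e01, e11, e00, e10]
  rw [show e₂ * (l * kDb a b) + e₁ * (l * kDa a b) = l * (e₂ * kDb a b + e₁ * kDa a b) by ring,
    show e₂ * (l * a) - e₁ * (l * b) = l * (e₂ * a - e₁ * b) by ring,
    mul_div_mul_left _ _ hl]

/-- `ap_mul_right` — step of Klein's icosahedral descent for the `3`–`5` switch (see the module docstring). [folklore] -/
private theorem ap_mul_right (g : Matrix (Fin 2) (Fin 2) F) (x y s : F) :
    ap g (x * s) (y * s) = ((ap g x y).1 * s, (ap g x y).2 * s) := by
  simp only [ap]
  refine Prod.ext ?_ ?_ <;> dsimp only <;> ring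

/-- **glue (PROVED): `t_e` is unchanged when `M_{v'} = g·M_v` and `e = (x:1)` is an eigenvector of
`g`.**  `M_v(t_e(v),1) = s·e` (`Mv_at_tE`), so `M_{v'}(t_e(v),1) = sν·e`, and this pins `t_e(v')`. [folklore] -/
private theorem tE_eq_of_eigen [CharZero F] (a b a' b' : F) (hD : kD a b ≠ 0) (x ν : F)
    (hg : ap (Gm a b a' b') x 1 = (ν * x, ν))
    (hne : 1 * a - x * b ≠ 0) (hne' : 1 * a' - x * b' ≠ 0) :
    tE a' b' x 1 = tE a b x 1 := by
  obtain ⟨h1, h2⟩ := Mv_at_tE a b x 1 hne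
  have key : ap (Mv a' b') (tE a b x 1) 1 =
      ap (Gm a b a' b') (Mv1 a b (tE a b x 1) 1) (Mv2 a b (tE a b x 1) 1) := by
    rw [← Gm_mul_Mv a b a' b' hD, ap_mul, ap_Mv]
  have h1' : Mv1 a b (tE a b x 1) 1 = x * (12 * kD a b / (1 * a - x * b)) := by rw [h1]; ring
  have h2' : Mv2 a b (tE a b x 1) 1 = 1 * (12 * kD a b / (1 * a - x * b)) := by rw [h2]; ring
  rw [h1', h2', ap_mul_right, hg, ap_Mv] at key
  have k1 := congrArg Prod.fst key
  have k2 := congrArg Prod.snd key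
  simp only [Mv1, Mv2] at k1 k2
  show (1 * kDb a' b' + x * kDa a' b') / (1 * a' - x * b') = tE a b x 1
  rw [div_eq_iff hne']
  linear_combination -k1 + x * k2

/-- **glue (PROVED): a `2 × 2` matrix over an algebraically closed field has an eigenvector.** [folklore] -/
private theorem exists_eigen [IsAlgClosed F] (g : Matrix (Fin 2) (Fin 2) F) :
    ∃ x y ν : F, (x, y) ≠ (0, 0) ∧ ap g x y = (ν * x, ν * y) := by
  by_cases h10 : g 1 0 = 0
  · refine ⟨1, 0, g 0 0, by simp, ?_⟩
    simp only [ap, h10]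
    refine Prod.ext ?_ ?_ <;> dsimp only <;> ring
  · -- a root `ν` of the characteristic polynomial, eigenvector `(ν - g₁₁, g₁₀)`
    open _root_.Polynomial in
    obtain ⟨ν, hν⟩ := IsAlgClosed.exists_root
      (C (1 : F) * X ^ 2 + C (-(g 0 0 + g 1 1)) * X + C (g 0 0 * g 1 1 - g 0 1 * g 1 0))
      (by rw [Polynomial.degree_quadratic (one_ne_zero)]; decide)
    have hν' : ν ^ 2 - (g 0 0 + g 1 1) * ν + (g 0 0 * g 1 1 - g 0 1 * g 1 0) = 0 := by
      have := hν
      simp only [Polynomial.IsRoot.def, Polynomial.eval_add, Polynomial.eval_mul, Polynomial.eval_C,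
        Polynomial.eval_pow, Polynomial.eval_X] at this
      linear_combination this
    refine ⟨ν - g 1 1, g 1 0, ν, ?_, ?_⟩
    · intro h
      exact h10 (congrArg Prod.snd h)
    · simp only [ap]
      refine Prod.ext ?_ ?_ <;> dsimp only
      · linear_combination -hν'
      · ring

/-- **H6 (PROVED here from L84-D / L84-C4, themselves PROVED in g9): the transition matrix
preserves `D` up to the scalar `c = D(v')/D(v)` and `c₄^{Kl}` EXACTLY.** [folklore] -/
private theorem klein_comp_Gm [CharZero F] (a b a' b' : F) (hD : kD a b ≠ 0)
    (h4 : kC4 a' b' = kC4 a b) (h6 : kC6 a' b' = kC6 a b) :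
    (∀ x y : F, kD (ap (Gm a b a' b') x y).1 (ap (Gm a b a' b') x y).2 = kD a' b' / kD a b * kD x y) ∧
    (∀ x y : F, kC4 (ap (Gm a b a' b') x y).1 (ap (Gm a b a' b') x y).2 = kC4 x y) := by
  have hu : IsUnit (Mv a b).det := by
    rw [Mv_det]; exact isUnit_iff_ne_zero.mpr (mul_ne_zero (by norm_num) hD)
  have hD' : kD a' b' ≠ 0 := by
    refine kD_ne_zero_of_ne a' b' ?_
    rw [h4, h6]
    intro h
    have := klein_syzygy a b
    rw [h, sub_self] at this
    exact hD (pow_eq_zero_iff (by norm_num) |>.mp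
      ((mul_eq_zero.mp this.symm).resolve_left (by norm_num)))
  have pre : ∀ x y : F,
      ap (Mv a b) (ap (Mv a b)⁻¹ x y).1 (ap (Mv a b)⁻¹ x y).2 = (x, y) := by
    intro x y
    rw [← ap_mul, Matrix.mul_nonsing_inv _ hu, ap_one]
  have hG : ∀ x y : F, ap (Gm a b a' b') x y =
      ap (Mv a' b') (ap (Mv a b)⁻¹ x y).1 (ap (Mv a b)⁻¹ x y).2 := by
    intro x y
    rw [Gm, ap_mul]
  refine ⟨fun x y => ?_, fun x y => ?_⟩
  · have e := pre x y
    rw [hG x y]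
    obtain ⟨L, hL⟩ : ∃ L, ap (Mv a b)⁻¹ x y = L := ⟨_, rfl⟩
    rw [hL] at e ⊢
    obtain ⟨l, m⟩ := L
    dsimp only at e ⊢
    rw [ap_Mv] at e ⊢
    have e1 := congrArg Prod.fst e
    have e2 := congrArg Prod.snd e
    dsimp only at e1 e2 ⊢
    have key := lemma84_D a b l m
    rw [e1, e2] at key
    rw [← lemma84_D a' b' l m, h4, h6, ← key, div_mul_eq_mul_div, eq_div_iff hD]
    ring
  · have e := pre x y
    rw [hG x y]
    obtain ⟨L, hL⟩ : ∃ L, ap (Mv a b)⁻¹ x y = L := ⟨_, rfl⟩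
    rw [hL] at e ⊢
    obtain ⟨l, m⟩ := L
    dsimp only at e ⊢
    rw [ap_Mv] at e ⊢
    have e1 := congrArg Prod.fst e
    have e2 := congrArg Prod.snd e
    dsimp only at e1 e2 ⊢
    have key := lemma84_C4 a b l m hD
    rw [e1, e2] at key
    rw [← lemma84_C4 a' b' l m hD', h4, h6, ← key]

/-- **I5 (S, certificate; kit j345457 A5/A9: `Res(D, c₄^{Kl}) = 5⁵⁰`, Bezout cofactors of degrees
19/10 with denominators `≤ 5⁵`): vertices are not face centres.** [folklore] -/
private theorem kC4_ne_zero_of_kD_eq_zero [CharZero F] (x y : F) (h0 : (x, y) ≠ (0, 0)) (hD : kD x y = 0) :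
    kC4 x y ≠ 0 := by
  intro h4
  apply h0
  -- `D = x·y·r` with `r = x¹⁰ − 11x⁵y⁵ − y¹⁰`, and `c₄^{Kl} ≡ 5⁵·y¹⁵(11x⁵ + y⁵) (mod r)`
  have hfac : x * y * (x ^ 10 - 11 * x ^ 5 * y ^ 5 - y ^ 10) = 0 := by
    rw [← hD]; simp only [kD]; ring
  have hid : kC4 x y = (x ^ 10 + 239 * x ^ 5 * y ^ 5 + 3124 * y ^ 10) *
      (x ^ 10 - 11 * x ^ 5 * y ^ 5 - y ^ 10) + 3125 * y ^ 15 * (11 * x ^ 5 + y ^ 5) := by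
    simp only [kC4]; ring
  have hx0 : ∀ {x y : F}, x = 0 → kC4 x y = 0 → (x, y) = (0, 0) := by
    intro x y hx h
    subst hx
    have : y ^ 20 = 0 := by simpa [kC4] using h
    rw [pow_eq_zero_iff (by norm_num)] at this
    rw [this]
  rcases mul_eq_zero.mp hfac with hxy | hr
  · rcases mul_eq_zero.mp hxy with hx | hy
    · exact hx0 hx h4
    · subst hy
      have : x ^ 20 = 0 := by simpa [kC4] using h4
      rw [pow_eq_zero_iff (by norm_num)] at this
      rw [this]
  · rw [h4, hr, mul_zero, zero_add] at hid
    rcases mul_eq_zero.mp hid.symm with h' | h'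
    · rcases mul_eq_zero.mp h' with h'' | h''
      · exact absurd h'' (by norm_num)
      · have hy : y = 0 := (pow_eq_zero_iff (by norm_num)).mp h''
        subst hy
        have hx : x ^ 10 = 0 := by simpa using hr
        rw [(pow_eq_zero_iff (by norm_num)).mp hx]
    · have hy5 : y ^ 5 = -11 * x ^ 5 := by linear_combination h'
      have hx10 : x ^ 10 = 0 := by
        have e : x ^ 10 = x ^ 10 - 11 * x ^ 5 * y ^ 5 - y ^ 10 := by
          rw [show y ^ 10 = (y ^ 5) ^ 2 by ring, hy5]; ring
        rw [e]; exact hr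
      have hx : x = 0 := (pow_eq_zero_iff (by norm_num)).mp hx10
      subst hx
      have hy : y = 0 := by
        have : y ^ 5 = 0 := by rw [hy5]; ring
        exact (pow_eq_zero_iff (by norm_num)).mp this
      rw [hy]

/-- **I2+I3 (S, "an even polynomial function has no linear Taylor term"), for `c₄^{Kl}`:** [folklore] -/
private theorem kC4_dir_deriv_eq_zero_of_even [CharZero F] (x y u w : F)
    (hev : ∀ t : F, kC4 (x + t * u) (y + t * w) = kC4 (x - t * u) (y - t * w)) :
    kC4a x y * u + kC4b x y * w = 0 := by
  haveI : Infinite F := Infinite.of_injective (Nat.cast : ℕ → F) Nat.cast_injective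
  have hP : kC4 (Polynomial.C x + Polynomial.C u * Polynomial.X)
        (Polynomial.C y + Polynomial.C w * Polynomial.X) =
      kC4 (Polynomial.C x + Polynomial.C (-u) * Polynomial.X)
        (Polynomial.C y + Polynomial.C (-w) * Polynomial.X) := by
    apply Polynomial.funext
    intro t
    rw [← Polynomial.coe_evalRingHom, map_kC4, map_kC4]
    simp only [Polynomial.coe_evalRingHom, Polynomial.eval_add, Polynomial.eval_mul,
      Polynomial.eval_C, Polynomial.eval_X]
    have h := hev t
    convert h using 2 <;> ring
  have hD := congrArg (fun p => (Polynomial.derivative p).eval 0) hP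
  rw [lineDeriv_kC4, lineDeriv_kC4] at hD
  have h2 : (2 : F) * (kC4a x y * u + kC4b x y * w) = 0 := by linear_combination hD
  exact (mul_eq_zero.mp h2).resolve_left two_ne_zero

/-- … and for `D`. [folklore] -/
private theorem kD_dir_deriv_eq_zero_of_even [CharZero F] (x y u w : F)
    (hev : ∀ t : F, kD (x + t * u) (y + t * w) = kD (x - t * u) (y - t * w)) :
    kDa x y * u + kDb x y * w = 0 := by
  haveI : Infinite F := Infinite.of_injective (Nat.cast : ℕ → F) Nat.cast_injective
  have hP : kD (Polynomial.C x + Polynomial.C u * Polynomial.X)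
        (Polynomial.C y + Polynomial.C w * Polynomial.X) =
      kD (Polynomial.C x + Polynomial.C (-u) * Polynomial.X)
        (Polynomial.C y + Polynomial.C (-w) * Polynomial.X) := by
    apply Polynomial.funext
    intro t
    rw [← Polynomial.coe_evalRingHom, map_kD, map_kD]
    simp only [Polynomial.coe_evalRingHom, Polynomial.eval_add, Polynomial.eval_mul,
      Polynomial.eval_C, Polynomial.eval_X]
    have h := hev t
    convert h using 2 <;> ring
  have hD := congrArg (fun p => (Polynomial.derivative p).eval 0) hP
  rw [lineDeriv_kD, lineDeriv_kD] at hD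
  have h2 : (2 : F) * (kDa x y * u + kDb x y * w) = 0 := by linear_combination hD
  exact (mul_eq_zero.mp h2).resolve_left two_ne_zero

/-- `ap_mul_left` — step of Klein's icosahedral descent for the `3`–`5` switch (see the module docstring). [folklore] -/
private theorem ap_mul_left (g : Matrix (Fin 2) (Fin 2) F) (s x y : F) :
    ap g (s * x) (s * y) = (s * (ap g x y).1, s * (ap g x y).2) := by
  simp only [ap]
  refine Prod.ext ?_ ?_ <;> dsimp only <;> ring

/-- `ap_add_mul` — step of Klein's icosahedral descent for the `3`–`5` switch (see the module docstring). [folklore] -/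
private theorem ap_add_mul (g : Matrix (Fin 2) (Fin 2) F) (x y t u w : F) :
    ap g (x + t * u) (y + t * w) =
      ((ap g x y).1 + t * (ap g u w).1, (ap g x y).2 + t * (ap g u w).2) := by
  simp only [ap]
  refine Prod.ext ?_ ?_ <;> dsimp only <;> ring

/-- **H9 = INV (THE NEW LEMMA; PROVED here from I2+I3 and I5): fixed points of a non-scalar
projective involution `g = M_{v'}M_v⁻¹` between two torsor points of the same `(c₄, c₆)` are EDGE
MIDPOINTS.**  By H6, `D∘g = c·D` with `c⁵ = 1` and `c₄^{Kl}∘g = c₄^{Kl}`; `g² = μ·1` gives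
`μ²⁰ = 1`, `c² = μ¹²`, so `c = ν³²` for the eigenvalue `ν` (`ν² = μ`); comparing at the eigenvector
forces `ν²⁰ = 1` (I5: `D`, `c₄^{Kl}` have no common zero), hence `c = ν¹²`, and then
`t ↦ c₄^{Kl}(e + te')`, `t ↦ D(e + te')` are even (`e'` the `−ν`-eigenvector), so (I2+I3) both
gradients at `e` kill `e'`, `Jac(D, c₄^{Kl})(e) = 20 c₆^{Kl}(e) = 0` (`klein_jacobian`), and
`c₄^{Kl}(e) ≠ 0` by the syzygy and I5. [folklore] -/
private theorem edge_of_eigenvector [CharZero F] (a b a' b' : F) (hne : kC4 a b ^ 3 ≠ kC6 a b ^ 2)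
    (h4 : kC4 a' b' = kC4 a b) (h6 : kC6 a' b' = kC6 a b)
    (μ : F) (hsq : Gm a b a' b' * Gm a b a' b' = μ • 1) (hns : ∀ l : F, Gm a b a' b' ≠ l • 1)
    (x y ν : F) (h0 : (x, y) ≠ (0, 0)) (he : ap (Gm a b a' b') x y = (ν * x, ν * y)) :
    kC6 x y = 0 ∧ kC4 x y ≠ 0 := by
  have hD : kD a b ≠ 0 := kD_ne_zero_of_ne a b hne
  have hD' : kD a' b' ≠ 0 := kD_ne_zero_of_ne a' b' (by rw [h4, h6]; exact hne)
  obtain ⟨hgD, hg4⟩ := klein_comp_Gm a b a' b' hD h4 h6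
  have hdetG : (Gm a b a' b').det ≠ 0 := Gm_det_ne a b a' b' hD hD'
  obtain ⟨G, hG⟩ : ∃ G, G = Gm a b a' b' := ⟨_, rfl⟩
  rw [← hG] at hsq hns he hgD hg4 hdetG
  obtain ⟨c, hc⟩ : ∃ c, c = kD a' b' / kD a b := ⟨_, rfl⟩
  rw [← hc] at hgD
  have hc0 : c ≠ 0 := by rw [hc]; exact div_ne_zero hD' hD
  -- `c⁵ = 1` from the syzygy for `v` and `v'`
  have hc5 : c ^ 5 = 1 := by
    have h1 := klein_syzygy a b
    have h2 := klein_syzygy a' b'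
    rw [h4, h6, h1] at h2
    have h3 : kD a b ^ 5 = kD a' b' ^ 5 := mul_left_cancel₀ (by norm_num : (1728 : F) ≠ 0) h2
    rw [hc, div_pow, ← h3, div_self (pow_ne_zero _ hD)]
  -- consequences of `G² = μ`
  have hsq_ap : ∀ u w : F, ap G (ap G u w).1 (ap G u w).2 = (μ * u, μ * w) := by
    intro u w
    rw [← ap_mul, hsq, ap_smul, ap_one]
  have hμ20 : μ ^ 20 = 1 := by
    have := hg4 (ap G 1 0).1 (ap G 1 0).2
    rw [hsq_ap, hg4] at this
    dsimp only at this
    rw [kC4_smul] at this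
    have h10 : kC4 (1 : F) 0 = 1 := by simp [kC4]
    rw [h10, mul_one] at this
    exact this
  have hc2 : c ^ 2 = μ ^ 12 := by
    have := hgD (ap G 1 1).1 (ap G 1 1).2
    rw [hsq_ap, hgD] at this
    dsimp only at this
    rw [kD_smul] at this
    have h11 : kD (1 : F) 1 = -11 := by simp only [kD]; norm_num
    rw [h11] at this
    have h' : (-11 : F) * c ^ 2 = (-11) * μ ^ 12 := by linear_combination -this
    exact mul_left_cancel₀ (by norm_num : (-11 : F) ≠ 0) h'
  -- the eigenvalue
  have hν0 : ν ≠ 0 := eigen_ne_zero G hdetG x y ν h0 he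
  have hν2 : ν ^ 2 = μ := by
    have h1 := hsq_ap x y
    rw [he] at h1
    dsimp only at h1
    rw [ap_mul_left, he] at h1
    dsimp only at h1
    have hx := congrArg Prod.fst h1
    have hy := congrArg Prod.snd h1
    dsimp only at hx hy
    by_contra hc'
    apply h0
    have hx' : (ν ^ 2 - μ) * x = 0 := by linear_combination hx
    have hy' : (ν ^ 2 - μ) * y = 0 := by linear_combination hy
    have hs : ν ^ 2 - μ ≠ 0 := sub_ne_zero.mpr hc'
    rw [Prod.mk.injEq]
    exact ⟨(mul_eq_zero.mp hx').resolve_left hs, (mul_eq_zero.mp hy').resolve_left hs⟩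
  have hν40 : ν ^ 40 = 1 := by rw [show ν ^ 40 = (ν ^ 2) ^ 20 by ring, hν2, hμ20]
  have hc32 : c = ν ^ 32 := by
    have h6' : c ^ 6 = ν ^ 32 := by
      rw [show c ^ 6 = (c ^ 2) ^ 3 by ring, hc2, ← hν2]
      linear_combination ν ^ 32 * hν40
    calc c = c * c ^ 5 := by rw [hc5, mul_one]
      _ = c ^ 6 := by ring
      _ = ν ^ 32 := h6'
  -- the second eigenvector `e' = (u, w)`: `G e' = -ν e'`
  have hE := fun i j => congrFun (congrFun hsq i) j
  have e00 := hE 0 0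
  have e01 := hE 0 1
  have e10 := hE 1 0
  have e11 := hE 1 1
  simp [Matrix.mul_apply, Fin.sum_univ_two, Matrix.smul_apply] at e00 e01 e10 e11
  obtain ⟨u, w, huw0, huw⟩ : ∃ u w : F, (u, w) ≠ (0, 0) ∧ ap G u w = (-ν * u, -ν * w) := by
    by_cases hp : (G 0 0 - ν, G 1 0) ≠ ((0 : F), (0 : F))
    · refine ⟨G 0 0 - ν, G 1 0, hp, ?_⟩
      simp only [ap]
      refine Prod.ext ?_ ?_ <;> dsimp only
      · linear_combination e00 - hν2
      · linear_combination e10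
    by_cases hq : (G 0 1, G 1 1 - ν) ≠ ((0 : F), (0 : F))
    · refine ⟨G 0 1, G 1 1 - ν, hq, ?_⟩
      simp only [ap]
      refine Prod.ext ?_ ?_ <;> dsimp only
      · linear_combination e01
      · linear_combination e11 - hν2
    exfalso
    push Not at hp hq
    rw [Prod.mk.injEq] at hp hq
    apply hns ν
    ext i j
    fin_cases i <;> fin_cases j <;> simp [Matrix.smul_apply]
    · linear_combination hp.1
    · exact hq.1
    · exact hp.2
    · linear_combination hq.2
  -- twisted evenness along `e'`
  have hev4 : ∀ t : F, kC4 (x + t * u) (y + t * w) = ν ^ 20 * kC4 (x - t * u) (y - t * w) := by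
    intro t
    have := hg4 (x + t * u) (y + t * w)
    rw [ap_add_mul, he, huw] at this
    dsimp only at this
    rw [show ν * x + t * (-ν * u) = ν * (x - t * u) by ring,
      show ν * y + t * (-ν * w) = ν * (y - t * w) by ring, kC4_smul] at this
    exact this.symm
  have hevD : ∀ t : F, c * kD (x + t * u) (y + t * w) = ν ^ 12 * kD (x - t * u) (y - t * w) := by
    intro t
    have := hgD (x + t * u) (y + t * w)
    rw [ap_add_mul, he, huw] at this
    dsimp only at this
    rw [show ν * x + t * (-ν * u) = ν * (x - t * u) by ring,
      show ν * y + t * (-ν * w) = ν * (y - t * w) by ring, kD_smul] at this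
    exact this.symm
  -- `ν²⁰ = 1` (here I5 enters), hence `c = ν¹²` and genuine evenness
  have hν20 : ν ^ 20 = 1 := by
    by_contra hν20
    have h4x : kC4 x y = 0 := by
      have h := hev4 0
      simp only [zero_mul, add_zero, sub_zero] at h
      have h' : (ν ^ 20 - 1) * kC4 x y = 0 := by linear_combination -h
      exact (mul_eq_zero.mp h').resolve_left (sub_ne_zero.mpr hν20)
    have hDx : kD x y ≠ 0 := fun h => kC4_ne_zero_of_kD_eq_zero x y h0 h h4x
    have hc12 : c = ν ^ 12 := by
      have h := hevD 0
      simp only [zero_mul, add_zero, sub_zero] at h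
      exact mul_right_cancel₀ hDx h
    apply hν20
    have key : ν ^ 12 * (ν ^ 20 - 1) = 0 := by linear_combination -hc32 + hc12
    exact sub_eq_zero.mp ((mul_eq_zero.mp key).resolve_left (pow_ne_zero _ hν0))
  have hc12 : c = ν ^ 12 := by rw [hc32]; linear_combination ν ^ 12 * hν20
  have hev4' : ∀ t : F, kC4 (x + t * u) (y + t * w) = kC4 (x - t * u) (y - t * w) := by
    intro t
    rw [hev4 t, hν20, one_mul]
  have hevD' : ∀ t : F, kD (x + t * u) (y + t * w) = kD (x - t * u) (y - t * w) := by
    intro t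
    have h := hevD t
    rw [hc12] at h
    exact mul_left_cancel₀ (pow_ne_zero _ hν0) h
  -- (I2+I3): both gradients at `e` kill `e'`, so the Jacobian vanishes at `e`
  have g4 := kC4_dir_deriv_eq_zero_of_even x y u w hev4'
  have gD := kD_dir_deriv_eq_zero_of_even x y u w hevD'
  have hJ : kDa x y * kC4b x y - kDb x y * kC4a x y = 0 := by
    have hu' : (kDa x y * kC4b x y - kDb x y * kC4a x y) * u = 0 := by
      linear_combination kC4b x y * gD - kDb x y * g4
    have hw' : (kDa x y * kC4b x y - kDb x y * kC4a x y) * w = 0 := by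
      linear_combination kDa x y * g4 - kC4a x y * gD
    by_contra hJ
    apply huw0
    rw [Prod.mk.injEq]
    exact ⟨(mul_eq_zero.mp hu').resolve_left hJ, (mul_eq_zero.mp hw').resolve_left hJ⟩
  have h6x : kC6 x y = 0 := by
    have h := klein_jacobian x y
    rw [hJ] at h
    exact (mul_eq_zero.mp h.symm).resolve_left (by norm_num)
  refine ⟨h6x, fun h4x => ?_⟩
  have h := klein_syzygy x y
  rw [h4x, h6x] at h
  have hDx : kD x y = 0 := by
    have h' : (1728 : F) * kD x y ^ 5 = 0 := by rw [← h]; norm_num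
    exact pow_eq_zero_iff (by norm_num) |>.mp ((mul_eq_zero.mp h').resolve_left (by norm_num))
  exact kC4_ne_zero_of_kD_eq_zero x y h0 hDx h4x

end KleinField

section KleinAlgClosed
variable {F : Type*} [Field F]

open _root_.Polynomial in
/-- **H2 = T1 (PROVED here; was open in g9): torsor points exist.**  Recipe (uses I5, proved above): the
polynomial `p(a) := c₆²·c₄^{Kl}(a,1)³ − c₄³·c₆^{Kl}(a,1)²` has degree EXACTLY 60 (leading coefficient
`c₆² − c₄³ ≠ 0`), so it has a root `a₀` (`IsAlgClosed.exists_root`); `c₄^{Kl}, c₆^{Kl}` have no common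
zero on `(a₀,1)` (syzygy + I5), so `v₀ = (a₀, 1)` has `c₄^{Kl}(v₀)³ : c₆^{Kl}(v₀)² = c₄³ : c₆²`; rescale
`v = λ v₀` with `λ¹⁰ = (c₆ c₄^{Kl}(v₀)) / (c₄ c₆^{Kl}(v₀))` (then `λ²⁰ = c₄/c₄^{Kl}(v₀)`,
`λ³⁰ = c₆/c₆^{Kl}(v₀)`); the cases `c₄ = 0` / `c₆ = 0` use a root of `c₄^{Kl}(a,1)` / `c₆^{Kl}(a,1)` and a
30th / 20th root. [folklore] -/
private theorem exists_torsorPoint [IsAlgClosed F] [CharZero F] (c₄ c₆ : F) (h : c₄ ^ 3 ≠ c₆ ^ 2) :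
    ∃ a b : F, kC4 a b = c₄ ∧ kC6 a b = c₆ := by
  -- the dehomogenised forms as honest polynomials
  have hA4 : kC4 (X : F[X]) 1 = X ^ 20 + 228 * X ^ 15 + 494 * X ^ 10 - 228 * X ^ 5 + 1 := by
    simp only [kC4]; ring
  have hA6 : kC6 (X : F[X]) 1 =
      -(X ^ 30 - 522 * X ^ 25 - 10005 * X ^ 20 - 10005 * X ^ 10 + 522 * X ^ 5 + 1) := by
    simp only [kC6]; ring
  have hm4 : (kC4 (X : F[X]) 1).Monic := by rw [hA4]; monicity!
  have hd4 : (kC4 (X : F[X]) 1).natDegree = 20 := by rw [hA4]; compute_degree!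
  have hm6 : (-kC6 (X : F[X]) 1).Monic := by rw [hA6, neg_neg]; monicity!
  have hd6 : (-kC6 (X : F[X]) 1).natDegree = 30 := by rw [hA6, neg_neg]; compute_degree!
  have ev4 : ∀ a : F, (kC4 (X : F[X]) 1).eval a = kC4 a 1 := by
    intro a; rw [← Polynomial.coe_evalRingHom, map_kC4]; simp
  have ev6 : ∀ a : F, (kC6 (X : F[X]) 1).eval a = kC6 a 1 := by
    intro a; rw [← Polynomial.coe_evalRingHom, map_kC6]; simp
  -- no common zero of `c₄^{Kl}(·,1)` and `c₆^{Kl}(·,1)` (syzygy + I5)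
  have hnc : ∀ a : F, kC4 a 1 = 0 → kC6 a 1 ≠ 0 := by
    intro a h4 h6
    have hs := klein_syzygy a 1
    rw [h4, h6] at hs
    have hD : kD a 1 = 0 := by
      have h' : (1728 : F) * kD a 1 ^ 5 = 0 := by rw [← hs]; norm_num
      exact pow_eq_zero_iff (by norm_num) |>.mp ((mul_eq_zero.mp h').resolve_left (by norm_num))
    exact kC4_ne_zero_of_kD_eq_zero a 1 (by simp) hD h4
  -- roots of the one-variable forms exist
  have root4 : ∃ a : F, kC4 a 1 = 0 := by
    have hdeg : (kC4 (X : F[X]) 1).degree ≠ 0 := by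
      rw [Polynomial.degree_eq_natDegree hm4.ne_zero, hd4]; decide
    obtain ⟨a, ha⟩ := IsAlgClosed.exists_root _ hdeg
    exact ⟨a, by rw [← ev4]; exact ha⟩
  have root6 : ∃ a : F, kC6 a 1 = 0 := by
    have hdeg : (-kC6 (X : F[X]) 1).degree ≠ 0 := by
      rw [Polynomial.degree_eq_natDegree hm6.ne_zero, hd6]; decide
    obtain ⟨a, ha⟩ := IsAlgClosed.exists_root _ hdeg
    refine ⟨a, ?_⟩
    have : (-kC6 (X : F[X]) 1).eval a = 0 := ha
    rw [Polynomial.eval_neg, neg_eq_zero, ev6] at this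
    exact this
  by_cases h4 : c₄ = 0
  · -- `c₄ = 0`, `c₆ ≠ 0`: a zero of `c₄^{Kl}` rescaled by a 30th root
    have h6 : c₆ ≠ 0 := by rintro rfl; apply h; rw [h4]; ring
    obtain ⟨a, ha⟩ := root4
    have hK6 := hnc a ha
    obtain ⟨l, hl⟩ := IsAlgClosed.exists_pow_nat_eq (c₆ / kC6 a 1) (by norm_num : 0 < 30)
    refine ⟨l * a, l * 1, ?_, ?_⟩
    · rw [kC4_smul, ha, mul_zero, h4]
    · rw [kC6_smul, hl, div_mul_cancel₀ _ hK6]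
  by_cases h6 : c₆ = 0
  · -- `c₆ = 0`, `c₄ ≠ 0`: a zero of `c₆^{Kl}` rescaled by a 20th root
    obtain ⟨a, ha⟩ := root6
    have hK4 : kC4 a 1 ≠ 0 := fun h4' => hnc a h4' ha
    obtain ⟨l, hl⟩ := IsAlgClosed.exists_pow_nat_eq (c₄ / kC4 a 1) (by norm_num : 0 < 20)
    refine ⟨l * a, l * 1, ?_, ?_⟩
    · rw [kC4_smul, hl, div_mul_cancel₀ _ hK4]
    · rw [kC6_smul, ha, mul_zero, h6]
  -- generic case: a root of `P := c₆² (c₄^{Kl})³ − c₄³ (c₆^{Kl})²`, of degree 60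
  obtain ⟨P, hP⟩ : ∃ P : F[X],
      P = Polynomial.C (c₆ ^ 2) * (kC4 (X : F[X]) 1) ^ 3 -
        Polynomial.C (c₄ ^ 3) * (kC6 (X : F[X]) 1) ^ 2 := ⟨_, rfl⟩
  have hc4 : ((kC4 (X : F[X]) 1) ^ 3).coeff 60 = 1 := by
    have hm := hm4.pow 3
    have hd : ((kC4 (X : F[X]) 1) ^ 3).natDegree = 60 := by rw [hm4.natDegree_pow, hd4]
    have := hm.coeff_natDegree; rwa [hd] at this
  have hc6 : ((kC6 (X : F[X]) 1) ^ 2).coeff 60 = 1 := by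
    have hm := hm6.pow 2
    have hd : ((-kC6 (X : F[X]) 1) ^ 2).natDegree = 60 := by rw [hm6.natDegree_pow, hd6]
    have := hm.coeff_natDegree; rw [hd, neg_pow, show ((-1 : F[X]) ^ 2) = 1 by norm_num,
      one_mul] at this; exact this
  have hP60 : P.coeff 60 = c₆ ^ 2 - c₄ ^ 3 := by
    rw [hP, Polynomial.coeff_sub, Polynomial.coeff_C_mul, Polynomial.coeff_C_mul, hc4, hc6]; ring
  have hdeg : P.degree ≠ 0 := by
    intro h0
    have h60 : ((60 : ℕ) : WithBot ℕ) ≤ P.degree :=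
      Polynomial.le_degree_of_ne_zero (by rw [hP60]; exact sub_ne_zero.mpr (Ne.symm h))
    rw [h0] at h60
    exact absurd h60 (by decide)
  obtain ⟨a, ha⟩ := IsAlgClosed.exists_root P hdeg
  have hPa : c₆ ^ 2 * kC4 a 1 ^ 3 - c₄ ^ 3 * kC6 a 1 ^ 2 = 0 := by
    have : P.eval a = 0 := ha
    rwa [hP, Polynomial.eval_sub, Polynomial.eval_mul, Polynomial.eval_mul, Polynomial.eval_C,
      Polynomial.eval_C, Polynomial.eval_pow, Polynomial.eval_pow, ev4, ev6] at this
  have hK4 : kC4 a 1 ≠ 0 := by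
    intro h4'
    have : c₄ ^ 3 * kC6 a 1 ^ 2 = 0 := by rw [h4'] at hPa; linear_combination -hPa
    rcases mul_eq_zero.mp this with h' | h'
    · exact h4 ((pow_eq_zero_iff (by norm_num)).mp h')
    · exact hnc a h4' ((pow_eq_zero_iff (by norm_num)).mp h')
  have hK6 : kC6 a 1 ≠ 0 := by
    intro h6'
    have : c₆ ^ 2 * kC4 a 1 ^ 3 = 0 := by rw [h6'] at hPa; linear_combination hPa
    rcases mul_eq_zero.mp this with h' | h'
    · exact h6 ((pow_eq_zero_iff (by norm_num)).mp h')
    · exact hK4 ((pow_eq_zero_iff (by norm_num)).mp h')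
  -- rescale by `λ` with `λ¹⁰ = t := (c₆/K6)/(c₄/K4)`; then `λ²⁰ K4 = c₄`, `λ³⁰ K6 = c₆`
  obtain ⟨t, ht⟩ : ∃ t : F, t = (c₆ * kC4 a 1) / (c₄ * kC6 a 1) := ⟨_, rfl⟩
  have ht2 : t ^ 2 * kC4 a 1 = c₄ := by
    rw [ht]; field_simp; linear_combination hPa
  have ht3 : t ^ 3 * kC6 a 1 = c₆ := by
    rw [ht]; field_simp; linear_combination hPa
  obtain ⟨l, hl⟩ := IsAlgClosed.exists_pow_nat_eq t (by norm_num : 0 < 10)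
  refine ⟨l * a, l * 1, ?_, ?_⟩
  · rw [kC4_smul, show l ^ 20 = (l ^ 10) ^ 2 by ring, hl, ht2]
  · rw [kC6_smul, show l ^ 30 = (l ^ 10) ^ 3 by ring, hl, ht3]

end KleinAlgClosed

/-! ## §4 NEW (g10): Galois side — three small helpers -/

section Galois


/-- **H1 (Galois glue; PROOF ATTEMPTED here): an element of `Γ_{ℚ(ζ₂₀)}` inverting `√−3`** (`√−3 ∉ ℚ(ζ₂₀) = ℚ(i, ζ₅)`,
whose quadratic subfields are `ℚ(i), ℚ(√5), ℚ(√−5)`).  Recipe: `F := ℚ⟮ζ₂₀⟯ ≤ (AlgebraicClosure ℚ)`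
(`IntermediateField.adjoin`), `[F(√−3) : F] = 2` from `ℚ(ζ₂₀, √−3) = ℚ(ζ₆₀)` of degree `φ(60) = 16 > 8`
(`Polynomial.cyclotomic.irreducible_rat`, `IsCyclotomicExtension.finrank`); the non-trivial
`F`-automorphism of `F(√−3)` extends to `(AlgebraicClosure ℚ)` (`IsAlgClosed.lift`, bijective by
`Algebra.IsAlgebraic.algHom_bijective`), and is transported to `Γ_ℚ = Field.absoluteGaloisGroup ℚ` by `Field.absoluteGaloisGroup.toAlgEquiv`. [folklore] -/
private theorem exists_sigma_fix20_negSqrt3 :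
    ∃ σ : (Field.absoluteGaloisGroup ℚ), (∀ z : (AlgebraicClosure ℚ), z ^ 20 = 1 → σ • z = z) ∧ (∀ s : (AlgebraicClosure ℚ), s ^ 2 = -3 → σ • s = -s) := by
  haveI : Algebra.IsAlgebraic ℚ (AlgebraicClosure ℚ) := AlgebraicClosure.isAlgebraic ℚ
  -- a primitive 20th root of unity `ζ` and a square root `r` of `−3`
  obtain ⟨ζ, hζ⟩ : ∃ ζ : (AlgebraicClosure ℚ), IsPrimitiveRoot ζ 20 := by
    have hdeg : (Polynomial.cyclotomic 20 (AlgebraicClosure ℚ)).degree ≠ 0 :=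
      (Polynomial.degree_cyclotomic_pos 20 (AlgebraicClosure ℚ) (by norm_num)).ne'
    obtain ⟨ζ, hζ⟩ := IsAlgClosed.exists_root _ hdeg
    exact ⟨ζ, Polynomial.isRoot_cyclotomic_iff.mp hζ⟩
  obtain ⟨r, hr⟩ : ∃ r : (AlgebraicClosure ℚ), r ^ 2 = -3 := IsAlgClosed.exists_pow_nat_eq (-3) (by norm_num)
  -- `K = ℚ(ζ) = ℚ(μ₂₀)`, of degree `φ(20) = 8`
  obtain ⟨K, hK⟩ : ∃ K : IntermediateField ℚ (AlgebraicClosure ℚ), K = IntermediateField.adjoin ℚ {ζ} := ⟨_, rfl⟩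
  have hζK : ζ ∈ K := by rw [hK]; exact IntermediateField.mem_adjoin_simple_self ℚ ζ
  have hζint : IsIntegral ℚ ζ := (Algebra.IsAlgebraic.isAlgebraic ζ).isIntegral
  have hKdeg : Module.finrank ℚ K = 8 := by
    rw [hK, IntermediateField.adjoin.finrank hζint, ← Polynomial.cyclotomic_eq_minpoly_rat hζ
      (by norm_num), Polynomial.natDegree_cyclotomic]
    decide
  haveI : FiniteDimensional ℚ K := by
    rw [hK]; exact IntermediateField.adjoin.finiteDimensional hζint
  -- `√−3 ∉ ℚ(μ₂₀)`: otherwise `ζ₃ ∈ K`, so `K ∋` a primitive 60th root of unity, `16 ≤ 8`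
  have hrK : r ∉ K := by
    intro hrK
    have h2K : (2 : (AlgebraicClosure ℚ)) ∈ K := by
      rw [← one_add_one_eq_two]; exact add_mem (one_mem K) (one_mem K)
    have hωK : (-1 + r) / 2 ∈ K := div_mem (add_mem (neg_mem (one_mem K)) hrK) h2K
    have hω : IsPrimitiveRoot ((-1 + r) / 2 : (AlgebraicClosure ℚ)) 3 := by
      refine (IsPrimitiveRoot.iff (by norm_num)).mpr ⟨?_, ?_⟩
      · linear_combination ((r - 3) / 8) * hr
      · intro l hl0 hl3 h
        interval_cases l
        · have h3 : r = 3 := by linear_combination 2 * h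
          rw [h3] at hr; norm_num at hr
        · have h3 : r = -3 := by linear_combination (-2) * h + (1 / 2) * hr
          rw [h3] at hr; norm_num at hr
    have h60 := IsPrimitiveRoot.pow_mul_pow_lcm hζ hω (by norm_num) (by norm_num)
    obtain ⟨μ, hμ⟩ : ∃ μ : (AlgebraicClosure ℚ), μ = ζ ^ (20 / Nat.factorizationLCMLeft 20 3) *
        ((-1 + r) / 2) ^ (3 / Nat.factorizationLCMRight 20 3) := ⟨_, rfl⟩
    rw [← hμ, show Nat.lcm 20 3 = 60 by decide] at h60
    have hμK : μ ∈ K := by rw [hμ]; exact mul_mem (pow_mem hζK _) (pow_mem hωK _)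
    have hμint : IsIntegral ℚ μ := (Algebra.IsAlgebraic.isAlgebraic μ).isIntegral
    have h16 : Module.finrank ℚ (IntermediateField.adjoin ℚ {μ}) = 16 := by
      rw [IntermediateField.adjoin.finrank hμint, ← Polynomial.cyclotomic_eq_minpoly_rat h60
        (by norm_num), Polynomial.natDegree_cyclotomic]
      decide
    have hle : IntermediateField.adjoin ℚ {μ} ≤ K := IntermediateField.adjoin_simple_le_iff.mpr hμK
    have := IntermediateField.finrank_le_of_le_right hle
    rw [h16, hKdeg] at this
    norm_num at this
  -- `σ ∈ Gal((AlgebraicClosure ℚ)/K)` with `σ(√−3) = −√−3`, from `minpoly_K(√−3) = X² + 3`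
  haveI : IsAlgClosure ℚ (AlgebraicClosure ℚ) := AlgebraicClosure.instIsAlgClosure ℚ
  haveI : Normal ℚ (AlgebraicClosure ℚ) := IsAlgClosure.normal ℚ (AlgebraicClosure ℚ)
  haveI : Normal K (AlgebraicClosure ℚ) := Normal.tower_top_of_normal ℚ K (AlgebraicClosure ℚ)
  have hrint : IsIntegral K r :=
    IsIntegral.tower_top ((Algebra.IsAlgebraic.isAlgebraic (R := ℚ) r).isIntegral)
  have hconj : IsConjRoot K r (-r) := by
    apply isConjRoot_of_aeval_eq_zero hrint
    have hdvd : minpoly K r ∣ Polynomial.X ^ 2 + 3 :=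
      minpoly.dvd K r (by
        simp only [map_add, map_pow, Polynomial.aeval_X, map_ofNat, hr]; norm_num)
    have h2 : 2 ≤ (minpoly K r).natDegree :=
      (minpoly.two_le_natDegree_iff hrint).mpr (by rintro ⟨k, hk⟩; exact hrK (hk ▸ k.2))
    have hq : (Polynomial.X ^ 2 + 3 : Polynomial K).Monic := by monicity!
    have hqd : (Polynomial.X ^ 2 + 3 : Polynomial K).natDegree = 2 := by compute_degree!
    have heq : Polynomial.X ^ 2 + 3 = minpoly K r :=
      Polynomial.eq_of_monic_of_dvd_of_natDegree_le (minpoly.monic hrint) hq hdvd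
        (by rw [hqd]; exact h2)
    rw [← heq]
    simp only [map_add, map_pow, Polynomial.aeval_X, map_ofNat]
    linear_combination hr
  obtain ⟨σ, hσ⟩ := hconj.exists_algEquiv
  have hσr : σ r = -r := by
    have := hσ; rw [map_neg] at this; linear_combination -this
  refine ⟨(Field.absoluteGaloisGroup.toAlgEquiv ℚ).symm (σ.restrictScalars ℚ), ?_, ?_⟩
  · intro z hz
    obtain ⟨i, -, rfl⟩ := hζ.eq_pow_of_pow_eq_one hz
    rw [Field.absoluteGaloisGroup.smul_def, MulEquiv.apply_symm_apply]
    show σ (ζ ^ i) = ζ ^ i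
    have : σ ζ = ζ := σ.commutes (⟨ζ, hζK⟩ : K)
    rw [map_pow, this]
  · intro s hs
    rw [Field.absoluteGaloisGroup.smul_def, MulEquiv.apply_symm_apply]
    show σ s = -s
    have hs' : (s - r) * (s + r) = 0 := by linear_combination hs - hr
    rcases mul_eq_zero.mp hs' with h | h
    · have : s = r := by linear_combination h
      rw [this, hσr]
    · have : s = -r := by linear_combination h
      rw [this, map_neg, hσr, neg_neg]

/-! ### G2 engine: `ℚ(ζ₂₀) = ℚ(i, η)`-identities for the edge midpoints (checked by `grind`) -/

/-- `g2_sqrt5` — step of Klein's icosahedral descent for the `3`–`5` switch (see the module docstring). [folklore] -/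
private theorem g2_sqrt5 {F : Type*} [Field F] (η : F) (hη : η ^ 4 + η ^ 3 + η ^ 2 + η + 1 = 0) :
    (2 * (-(η ^ 2 + η ^ 3)) - 1) ^ 2 = 5 := by
  grind

/-- `x¹⁰ − u₊x⁵ − 1 = (x⁵ − (φ+c)⁵)(x⁵ − (φ−c)⁵)`, `φ = 2cos(π/5)`, `c = 2cos(π/10)`, `u₊ = 261+125√5`. [folklore] -/
private theorem g2_factorP {F : Type*} [Field F] (η i x : F) (hη : η ^ 4 + η ^ 3 + η ^ 2 + η + 1 = 0)
    (hi : i ^ 2 = -1) :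
    x ^ 10 - (261 + 125 * (2 * (-(η ^ 2 + η ^ 3)) - 1)) * x ^ 5 - 1 =
      (x ^ 5 - (-(η ^ 2 + η ^ 3) + i * (η ^ 4 - η)) ^ 5) *
        (x ^ 5 - (-(η ^ 2 + η ^ 3) - i * (η ^ 4 - η)) ^ 5) := by
  grind

/-- the `√5 ↦ −√5` conjugate: `φ' = −1/φ`, `c' = 2cos(3π/10)`, `u₋ = 261 − 125√5`. [folklore] -/
private theorem g2_factorM {F : Type*} [Field F] (η i x : F) (hη : η ^ 4 + η ^ 3 + η ^ 2 + η + 1 = 0)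
    (hi : i ^ 2 = -1) :
    x ^ 10 - (261 - 125 * (2 * (-(η ^ 2 + η ^ 3)) - 1)) * x ^ 5 - 1 =
      (x ^ 5 - (-(η + η ^ 4) + i * (η ^ 3 - η ^ 2)) ^ 5) *
        (x ^ 5 - (-(η + η ^ 4) - i * (η ^ 3 - η ^ 2)) ^ 5) := by
  grind

/-- `g2_unitP` — step of Klein's icosahedral descent for the `3`–`5` switch (see the module docstring). [folklore] -/
private theorem g2_unitP {F : Type*} [Field F] (η i : F) (hη : η ^ 4 + η ^ 3 + η ^ 2 + η + 1 = 0)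
    (hi : i ^ 2 = -1) :
    (-(η ^ 2 + η ^ 3) + i * (η ^ 4 - η)) * (-(η ^ 2 + η ^ 3) - i * (η ^ 4 - η)) = -1 := by
  grind

/-- `g2_unitM` — step of Klein's icosahedral descent for the `3`–`5` switch (see the module docstring). [folklore] -/
private theorem g2_unitM {F : Type*} [Field F] (η i : F) (hη : η ^ 4 + η ^ 3 + η ^ 2 + η + 1 = 0)
    (hi : i ^ 2 = -1) :
    (-(η + η ^ 4) + i * (η ^ 3 - η ^ 2)) * (-(η + η ^ 4) - i * (η ^ 3 - η ^ 2)) = -1 := by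
  grind

/-- `smul_eq_of_pow_five_eq` — step of Klein's icosahedral descent for the `3`–`5` switch (see the module docstring). [folklore] -/
private theorem smul_eq_of_pow_five_eq (σ : (Field.absoluteGaloisGroup ℚ)) (h5 : ∀ z : (AlgebraicClosure ℚ), z ^ 5 = 1 → σ • z = z)
    {x r : (AlgebraicClosure ℚ)} (hr : r ≠ 0) (hσr : σ • r = r) (h5' : x ^ 5 = r ^ 5) : σ • x = x := by
  have hω : (x / r) ^ 5 = 1 := by rw [div_pow, h5', div_self (pow_ne_zero _ hr)]
  have hx : x = (x / r) * r := (div_mul_cancel₀ x hr).symm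
  rw [hx, smul_mul', h5 _ hω, hσr]

/-! ### G1 (was g9's): the twelve vertices are `ℚ(ζ₅)`-rational -/

/-- `g1_factor` — step of Klein's icosahedral descent for the `3`–`5` switch (see the module docstring). [folklore] -/
private theorem g1_factor {F : Type*} [Field F] (η x : F) (hη : η ^ 4 + η ^ 3 + η ^ 2 + η + 1 = 0) :
    x ^ 10 - 11 * x ^ 5 - 1 = (x ^ 5 - (-(η ^ 2 + η ^ 3)) ^ 5) * (x ^ 5 - (-(η + η ^ 4)) ^ 5) := by
  grind

/-- `g1_unit` — step of Klein's icosahedral descent for the `3`–`5` switch (see the module docstring). [folklore] -/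
private theorem g1_unit {F : Type*} [Field F] (η : F) (hη : η ^ 4 + η ^ 3 + η ^ 2 + η + 1 = 0) :
    (-(η ^ 2 + η ^ 3)) * (-(η + η ^ 4)) = -1 := by
  grind

/-- the golden ratio `φ = −(η² + η³)` is a vertex: `D(φ, 1) = 0`. [folklore] -/
private theorem g1_vertex {F : Type*} [Field F] (η : F) (hη : η ^ 4 + η ^ 3 + η ^ 2 + η + 1 = 0) :
    kD (-(η ^ 2 + η ^ 3)) (1 : F) = 0 := by
  simp only [kD]; grind

open _root_.Polynomial in
/-- `exists_phi5_root` — step of Klein's icosahedral descent for the `3`–`5` switch (see the module docstring). [folklore] -/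
private theorem exists_phi5_root : ∃ η : (AlgebraicClosure ℚ), η ^ 4 + η ^ 3 + η ^ 2 + η + 1 = 0 := by
  have hdeg : (X ^ 4 + X ^ 3 + X ^ 2 + X + 1 : Polynomial (AlgebraicClosure ℚ)).degree ≠ 0 := by
    have : (X ^ 4 + X ^ 3 + X ^ 2 + X + 1 : Polynomial (AlgebraicClosure ℚ)).degree = 4 := by compute_degree!
    rw [this]; decide
  obtain ⟨η, hη⟩ := IsAlgClosed.exists_root _ hdeg
  refine ⟨η, ?_⟩
  have : (X ^ 4 + X ^ 3 + X ^ 2 + X + 1 : Polynomial (AlgebraicClosure ℚ)).eval η = 0 := hη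
  simpa only [Polynomial.eval_add, Polynomial.eval_pow, Polynomial.eval_X,
    Polynomial.eval_one] using this

/-- `phi5_root_fixed` — step of Klein's icosahedral descent for the `3`–`5` switch (see the module docstring). [folklore] -/
private theorem phi5_root_fixed (σ : (Field.absoluteGaloisGroup ℚ)) (h5 : ∀ z : (AlgebraicClosure ℚ), z ^ 5 = 1 → σ • z = z) {η : (AlgebraicClosure ℚ)}
    (hη : η ^ 4 + η ^ 3 + η ^ 2 + η + 1 = 0) : σ • η = η :=
  h5 η (by linear_combination (η - 1) * hη)

/-- **G1 (PROVED): every root of `D(x,1) = x(x¹⁰ − 11x⁵ − 1)` is fixed by `σ ⊇ μ₅`**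
(`x = 0` or `x⁵ = φ⁵, φ'⁵` with `φ, φ' = −1/φ ∈ ℚ(ζ₅)`). [folklore] -/
private theorem vertex_fixed (σ : (Field.absoluteGaloisGroup ℚ)) (h5 : ∀ z : (AlgebraicClosure ℚ), z ^ 5 = 1 → σ • z = z) (x : (AlgebraicClosure ℚ))
    (hx : kD x 1 = 0) : σ • x = x := by
  obtain ⟨η, hη⟩ := exists_phi5_root
  have fixH : Field.absoluteGaloisGroup.toAlgEquiv ℚ σ η = η := phi5_root_fixed σ h5 hη
  have hx' : x * (x ^ 10 - 11 * x ^ 5 - 1) = 0 := by rw [← hx]; simp only [kD]; ring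
  rcases mul_eq_zero.mp hx' with h0 | h
  · rw [h0, smul_zero]
  obtain ⟨φ, hφ⟩ : ∃ φ : (AlgebraicClosure ℚ), φ = -(η ^ 2 + η ^ 3) := ⟨_, rfl⟩
  obtain ⟨φ', hφ'⟩ : ∃ φ' : (AlgebraicClosure ℚ), φ' = -(η + η ^ 4) := ⟨_, rfl⟩
  have hσφ : σ • φ = φ := by
    rw [Field.absoluteGaloisGroup.smul_def, hφ]; simp only [map_neg, map_add, map_pow, fixH]
  have hσφ' : σ • φ' = φ' := by
    rw [Field.absoluteGaloisGroup.smul_def, hφ']; simp only [map_neg, map_add, map_pow, fixH]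
  have hprod : φ * φ' = -1 := by rw [hφ, hφ']; exact g1_unit η hη
  have h1 : φ ≠ 0 := fun h => by rw [h, zero_mul] at hprod; norm_num at hprod
  have h2 : φ' ≠ 0 := fun h => by rw [h, mul_zero] at hprod; norm_num at hprod
  have hf : x ^ 10 - 11 * x ^ 5 - 1 = (x ^ 5 - φ ^ 5) * (x ^ 5 - φ' ^ 5) := by
    rw [hφ, hφ']; exact g1_factor η x hη
  rw [hf, mul_eq_zero] at h
  rcases h with h | h
  · exact smul_eq_of_pow_five_eq σ h5 h1 hσφ (sub_eq_zero.mp h)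
  · exact smul_eq_of_pow_five_eq σ h5 h2 hσφ' (sub_eq_zero.mp h)

open _root_.Polynomial in
/-- **G2 (PROVED here; was open in g9; kit j345457 A11: `c₆^{Kl}(x,1)` splits into 30 linear factors over
`ℚ(ζ₂₀)`): edge midpoints are `ℚ(ζ₂₀)`-rational.**  Recipe: `c₆^{Kl}(x,1) = −(x²+1)·∏(x − e_j)` with the
30 roots `i^a ζ₅^b·(explicit units of ℚ(ζ₂₀))` — equivalently the orbit of `i` under Klein's generators
`S, T, U ∈ GL₂(ℚ(ζ₂₀))` (kit A12); prove the factorisation by `ring` modulo `Φ₂₀(ζ) = 0`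
(`Polynomial.X_pow_sub_C_eq_prod` blocks of 5 as in H8/K2), then `σ` fixes each root. [folklore] -/
private theorem edge_fixed (σ : (Field.absoluteGaloisGroup ℚ)) (h20 : ∀ z : (AlgebraicClosure ℚ), z ^ 20 = 1 → σ • z = z) (x : (AlgebraicClosure ℚ))
    (hx : kC6 x 1 = 0) : σ • x = x := by
  -- `ℚ(ζ₂₀) = ℚ(i, η)` with `i² = −1`, `Φ₅(η) = 0`
  have h5 : ∀ z : (AlgebraicClosure ℚ), z ^ 5 = 1 → σ • z = z := fun z hz =>
    h20 z (by rw [show (20 : ℕ) = 5 * 4 from rfl, pow_mul, hz, one_pow])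
  obtain ⟨i, hi⟩ : ∃ i : (AlgebraicClosure ℚ), i ^ 2 = -1 := IsAlgClosed.exists_pow_nat_eq (-1) (by norm_num)
  obtain ⟨η, hη⟩ := exists_phi5_root
  have hσi : σ • i = i :=
    h20 i (by rw [show (20 : ℕ) = 2 * 10 from rfl, pow_mul, hi]; norm_num)
  have fixI : Field.absoluteGaloisGroup.toAlgEquiv ℚ σ i = i := hσi
  have fixH : Field.absoluteGaloisGroup.toAlgEquiv ℚ σ η = η := phi5_root_fixed σ h5 hη
  -- `φ = 2cos(π/5)`, `c = 2cos(π/10)`, and their `√5 ↦ −√5` conjugates `φ'`, `c' = 2cos(3π/10)`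
  obtain ⟨φ, hφ⟩ : ∃ φ : (AlgebraicClosure ℚ), φ = -(η ^ 2 + η ^ 3) := ⟨_, rfl⟩
  obtain ⟨c, hc⟩ : ∃ c : (AlgebraicClosure ℚ), c = i * (η ^ 4 - η) := ⟨_, rfl⟩
  obtain ⟨φ', hφ'⟩ : ∃ φ' : (AlgebraicClosure ℚ), φ' = -(η + η ^ 4) := ⟨_, rfl⟩
  obtain ⟨c', hc'⟩ : ∃ c' : (AlgebraicClosure ℚ), c' = i * (η ^ 3 - η ^ 2) := ⟨_, rfl⟩
  have hσφ : σ • φ = φ := by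
    rw [Field.absoluteGaloisGroup.smul_def, hφ]; simp only [map_neg, map_add, map_pow, fixH]
  have hσc : σ • c = c := by
    rw [Field.absoluteGaloisGroup.smul_def, hc]; simp only [map_mul, map_sub, map_pow, fixH, fixI]
  have hσφ' : σ • φ' = φ' := by
    rw [Field.absoluteGaloisGroup.smul_def, hφ']; simp only [map_neg, map_add, map_pow, fixH]
  have hσc' : σ • c' = c' := by
    rw [Field.absoluteGaloisGroup.smul_def, hc']; simp only [map_mul, map_sub, map_pow, fixH, fixI]
  -- `√5 = 2φ − 1` and the factorisation of `c₆^{Kl}(x,1)` over `ℚ(√5)`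
  have hs2 : (2 * φ - 1) ^ 2 = 5 := by rw [hφ]; exact g2_sqrt5 η hη
  have hfac : kC6 x 1 = -((x ^ 10 + 1) * ((x ^ 10 - (261 + 125 * (2 * φ - 1)) * x ^ 5 - 1) *
      (x ^ 10 - (261 - 125 * (2 * φ - 1)) * x ^ 5 - 1))) := by
    simp only [kC6]; linear_combination (-15625 * (x ^ 10 + 1) * x ^ 10) * hs2
  rw [hfac, neg_eq_zero, mul_eq_zero, mul_eq_zero] at hx
  rcases hx with h10 | hP5 | hM5
  · -- `x ∈ μ₂₀`
    apply h20
    have : x ^ 10 = -1 := by linear_combination h10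
    rw [show (20 : ℕ) = 10 * 2 from rfl, pow_mul, this]; norm_num
  · -- `x⁵ = (φ ± c)⁵`: the edges around the vertices `∞`, `0`
    have hf : x ^ 10 - (261 + 125 * (2 * φ - 1)) * x ^ 5 - 1 =
        (x ^ 5 - (φ + c) ^ 5) * (x ^ 5 - (φ - c) ^ 5) := by rw [hφ, hc]; exact g2_factorP η i x hη hi
    have hprod : (φ + c) * (φ - c) = -1 := by rw [hφ, hc]; exact g2_unitP η i hη hi
    have hr1 : φ + c ≠ 0 := fun h => by rw [h, zero_mul] at hprod; norm_num at hprod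
    have hr2 : φ - c ≠ 0 := fun h => by rw [h, mul_zero] at hprod; norm_num at hprod
    rw [hf, mul_eq_zero] at hP5
    rcases hP5 with h | h
    · exact smul_eq_of_pow_five_eq σ h5 hr1 (by rw [smul_add, hσφ, hσc]) (sub_eq_zero.mp h)
    · exact smul_eq_of_pow_five_eq σ h5 hr2 (by rw [smul_sub, hσφ, hσc]) (sub_eq_zero.mp h)
  · -- `x⁵ = (φ' ± c')⁵`: the remaining ten edges
    have hf : x ^ 10 - (261 - 125 * (2 * φ - 1)) * x ^ 5 - 1 =
        (x ^ 5 - (φ' + c') ^ 5) * (x ^ 5 - (φ' - c') ^ 5) := by rw [hφ, hφ', hc']; exact g2_factorM η i x hη hi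
    have hprod : (φ' + c') * (φ' - c') = -1 := by rw [hφ', hc']; exact g2_unitM η i hη hi
    have hr1 : φ' + c' ≠ 0 := fun h => by rw [h, zero_mul] at hprod; norm_num at hprod
    have hr2 : φ' - c' ≠ 0 := fun h => by rw [h, mul_zero] at hprod; norm_num at hprod
    rw [hf, mul_eq_zero] at hM5
    rcases hM5 with h | h
    · exact smul_eq_of_pow_five_eq σ h5 hr1 (by rw [smul_add, hσφ', hσc']) (sub_eq_zero.mp h)
    · exact smul_eq_of_pow_five_eq σ h5 hr2 (by rw [smul_sub, hσφ', hσc']) (sub_eq_zero.mp h)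

/-- **H7′ (PROVED; replaces g10-draft H7 "finite projective order"): Galois orbits are finite, so
some positive power of `σ` fixes `a`** (pigeonhole on the root set of `minpoly ℚ a`).  With H8 at
`k = P` this gives `g_σ^P ∝ g_{σ^P} = 1`, i.e. the finite projective order of `g_σ`, for free. [folklore] -/
private theorem exists_pos_pow_smul_eq (σ : (Field.absoluteGaloisGroup ℚ)) (a : (AlgebraicClosure ℚ)) : ∃ P : ℕ, 0 < P ∧ (σ ^ P) • a = a := by
  classical
  haveI : Algebra.IsAlgebraic ℚ (AlgebraicClosure ℚ) := AlgebraicClosure.isAlgebraic ℚ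
  have hint : IsIntegral ℚ a := (Algebra.IsAlgebraic.isAlgebraic a).isIntegral
  have hroot : ∀ k : ℕ, (σ ^ k) • a ∈ (minpoly ℚ a).rootSet (AlgebraicClosure ℚ) := by
    intro k
    rw [Polynomial.mem_rootSet_of_ne (minpoly.ne_zero hint), Field.absoluteGaloisGroup.smul_def]
    have key := Polynomial.aeval_algHom_apply
      (AlgEquiv.toAlgHom (Field.absoluteGaloisGroup.toAlgEquiv ℚ (σ ^ k))) a (minpoly ℚ a)
    rw [minpoly.aeval, map_zero] at key
    exact key
  have hfin := Polynomial.rootSet_finite (minpoly ℚ a) (AlgebraicClosure ℚ)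
  obtain ⟨i, j, hij, heq⟩ : ∃ i j : ℕ, i ≠ j ∧ (σ ^ i) • a = (σ ^ j) • a := by
    by_contra hcon
    push Not at hcon
    have hinj : Function.Injective (fun k : ℕ => (σ ^ k) • a) :=
      fun i j h => by_contra fun hne => hcon i j hne h
    exact Set.infinite_of_injective_forall_mem hinj hroot hfin
  -- wlog `i < j`; cancel `σ^i`
  have main : ∀ i j : ℕ, i < j → (σ ^ i) • a = (σ ^ j) • a → ∃ P : ℕ, 0 < P ∧ (σ ^ P) • a = a := by
    intro i j h heq
    refine ⟨j - i, Nat.sub_pos_of_lt h, ?_⟩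
    apply MulAction.injective (σ ^ i)
    dsimp only
    rw [smul_smul, ← pow_add, Nat.add_sub_cancel' h.le, ← heq]
  rcases Nat.lt_or_gt_of_ne hij with h | h
  · exact main i j h heq
  · exact main j i h heq.symm

/-! ### proved Galois glue -/

/-- `smul_fix_pow` — step of Klein's icosahedral descent for the `3`–`5` switch (see the module docstring). [folklore] -/
private theorem smul_fix_pow (σ : (Field.absoluteGaloisGroup ℚ)) {z : (AlgebraicClosure ℚ)} (h : σ • z = z) (k : ℕ) : (σ ^ k) • z = z := by
  induction k with
  | zero => simp
  | succ k ih => rw [pow_succ, mul_smul, h, ih]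

/-- `smul_neg_pow_odd` — step of Klein's icosahedral descent for the `3`–`5` switch (see the module docstring). [folklore] -/
private theorem smul_neg_pow_odd (σ : (Field.absoluteGaloisGroup ℚ)) {s : (AlgebraicClosure ℚ)} (h : σ • s = -s) {k : ℕ} (hk : Odd k) :
    (σ ^ k) • s = -s := by
  obtain ⟨j, rfl⟩ := hk
  have h2 : (σ ^ 2) • s = s := by rw [pow_two, mul_smul, h, smul_neg, h, neg_neg]
  rw [pow_succ, mul_smul, h, smul_neg, pow_mul, smul_fix_pow (σ ^ 2) h2 j]

/-- `smul_kC4` — step of Klein's icosahedral descent for the `3`–`5` switch (see the module docstring). [folklore] -/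
private theorem smul_kC4 (τ : (Field.absoluteGaloisGroup ℚ)) (a b : (AlgebraicClosure ℚ)) : τ • kC4 a b = kC4 (τ • a) (τ • b) := by
  simp only [Field.absoluteGaloisGroup.smul_def, kC4, map_add, map_sub, map_mul, map_pow, map_ofNat]

/-- `smul_kC6` — step of Klein's icosahedral descent for the `3`–`5` switch (see the module docstring). [folklore] -/
private theorem smul_kC6 (τ : (Field.absoluteGaloisGroup ℚ)) (a b : (AlgebraicClosure ℚ)) : τ • kC6 a b = kC6 (τ • a) (τ • b) := by
  simp only [Field.absoluteGaloisGroup.smul_def, kC6, map_add, map_sub, map_neg, map_mul, map_pow,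
    map_ofNat]

/-- `smul_tE` — step of Klein's icosahedral descent for the `3`–`5` switch (see the module docstring). [folklore] -/
private theorem smul_tE (τ : (Field.absoluteGaloisGroup ℚ)) (a b e₁ e₂ : (AlgebraicClosure ℚ)) :
    τ • tE a b e₁ e₂ = tE (τ • a) (τ • b) (τ • e₁) (τ • e₂) := by
  simp only [Field.absoluteGaloisGroup.smul_def, tE, kDa, kDb, map_div₀, map_add, map_sub, map_mul,
    map_pow, map_ofNat]

/-! ### H8 machinery (g10, PROVED): `σ` acting on matrices, the cocycle, and `σ(g_σ) ∝ g_σ` -/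

/-- `smul_kD` — step of Klein's icosahedral descent for the `3`–`5` switch (see the module docstring). [folklore] -/
private theorem smul_kD (τ : (Field.absoluteGaloisGroup ℚ)) (a b : (AlgebraicClosure ℚ)) : τ • kD a b = kD (τ • a) (τ • b) := by
  simp only [Field.absoluteGaloisGroup.smul_def, kD, map_sub, map_mul, map_pow, map_ofNat]

/-- `σ` applied entrywise to a `2 × 2` matrix (a ring homomorphism). [folklore] -/
private noncomputable def gal (σ : (Field.absoluteGaloisGroup ℚ)) : Matrix (Fin 2) (Fin 2) (AlgebraicClosure ℚ) →+* Matrix (Fin 2) (Fin 2) (AlgebraicClosure ℚ) :=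
  ((Field.absoluteGaloisGroup.toAlgEquiv ℚ σ : (AlgebraicClosure ℚ) ≃ₐ[ℚ] (AlgebraicClosure ℚ)) : (AlgebraicClosure ℚ) →+* (AlgebraicClosure ℚ)).mapMatrix

/-- `gal_apply` — step of Klein's icosahedral descent for the `3`–`5` switch (see the module docstring). [folklore] -/
private theorem gal_apply (σ : (Field.absoluteGaloisGroup ℚ)) (M : Matrix (Fin 2) (Fin 2) (AlgebraicClosure ℚ)) (i j : Fin 2) :
    gal σ M i j = σ • M i j := by
  simp [gal, Field.absoluteGaloisGroup.smul_def]

/-- `gal_smul` — step of Klein's icosahedral descent for the `3`–`5` switch (see the module docstring). [folklore] -/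
private theorem gal_smul (σ : (Field.absoluteGaloisGroup ℚ)) (μ : (AlgebraicClosure ℚ)) (M : Matrix (Fin 2) (Fin 2) (AlgebraicClosure ℚ)) :
    gal σ (μ • M) = (σ • μ) • gal σ M := by
  ext i j; simp only [gal_apply, Matrix.smul_apply, smul_eq_mul, smul_mul']

/-- `gal_det` — step of Klein's icosahedral descent for the `3`–`5` switch (see the module docstring). [folklore] -/
private theorem gal_det (σ : (Field.absoluteGaloisGroup ℚ)) (M : Matrix (Fin 2) (Fin 2) (AlgebraicClosure ℚ)) : (gal σ M).det = σ • M.det := by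
  simp only [Matrix.det_fin_two, gal_apply, smul_sub, smul_mul']

/-- `gal_Mv` — step of Klein's icosahedral descent for the `3`–`5` switch (see the module docstring). [folklore] -/
private theorem gal_Mv (σ : (Field.absoluteGaloisGroup ℚ)) (a b : (AlgebraicClosure ℚ)) : gal σ (Mv a b) = Mv (σ • a) (σ • b) := by
  ext i j
  fin_cases i <;> fin_cases j <;>
    simp [gal_apply, Mv, kDa, kDb, Field.absoluteGaloisGroup.smul_def, map_sub, map_mul, map_pow,
      map_ofNat]

/-- `ap_gal` — step of Klein's icosahedral descent for the `3`–`5` switch (see the module docstring). [folklore] -/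
private theorem ap_gal (σ : (Field.absoluteGaloisGroup ℚ)) (M : Matrix (Fin 2) (Fin 2) (AlgebraicClosure ℚ)) (x y : (AlgebraicClosure ℚ)) :
    ap (gal σ M) (σ • x) (σ • y) = (σ • (ap M x y).1, σ • (ap M x y).2) := by
  simp only [ap, gal_apply, smul_add, smul_mul']

/-- **K1 (PROVED), the cocycle:** `g_{σ∘w} = σ(g_w) · g_σ`. [folklore] -/
private theorem Gm_cocycle (σ : (Field.absoluteGaloisGroup ℚ)) (a b a' b' : (AlgebraicClosure ℚ)) (hD : kD a b ≠ 0) :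
    Gm a b (σ • a') (σ • b') = gal σ (Gm a b a' b') * Gm a b (σ • a) (σ • b) := by
  calc Gm a b (σ • a') (σ • b') = Mv (σ • a') (σ • b') * (Mv a b)⁻¹ := rfl
    _ = gal σ (Mv a' b') * (Mv a b)⁻¹ := by rw [gal_Mv]
    _ = gal σ (Gm a b a' b' * Mv a b) * (Mv a b)⁻¹ := by rw [Gm_mul_Mv a b a' b' hD]
    _ = gal σ (Gm a b a' b') * (Mv (σ • a) (σ • b) * (Mv a b)⁻¹) := by
      rw [map_mul, gal_Mv, Matrix.mul_assoc]
    _ = gal σ (Gm a b a' b') * Gm a b (σ • a) (σ • b) := rfl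

/-- **K2 (PROVED), the key rigidity:** `σ(g_σ) = λ·g_σ` — `σ(g_σ) g_σ⁻¹` fixes the three
`σ`-fixed vertex lines `(1:0), (0:1), (φ:1)` because `g_σ` maps vertices to vertices (H6) and
every vertex line is `σ`-fixed (G1). [folklore] -/
private theorem gal_Gm_eq_smul (c₄ c₆ : ℤ) (hc : (c₄ : (AlgebraicClosure ℚ)) ^ 3 ≠ (c₆ : (AlgebraicClosure ℚ)) ^ 2) (a b : (AlgebraicClosure ℚ))
    (hv : kC4 a b = c₄ ∧ kC6 a b = c₆) (σ : (Field.absoluteGaloisGroup ℚ)) (h5 : ∀ z : (AlgebraicClosure ℚ), z ^ 5 = 1 → σ • z = z) :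
    ∃ l : (AlgebraicClosure ℚ), l ≠ 0 ∧ gal σ (Gm a b (σ • a) (σ • b)) = l • Gm a b (σ • a) (σ • b) := by
  have hne : kC4 a b ^ 3 ≠ kC6 a b ^ 2 := by rw [hv.1, hv.2]; exact hc
  have hD : kD a b ≠ 0 := kD_ne_zero_of_ne a b hne
  have hDσ : kD (σ • a) (σ • b) ≠ 0 := by
    rw [← smul_kD, Field.absoluteGaloisGroup.smul_def]
    have := (Field.absoluteGaloisGroup.toAlgEquiv ℚ σ).injective.ne hD
    rwa [map_zero] at this
  have h4 : kC4 (σ • a) (σ • b) = kC4 a b := by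
    rw [← smul_kC4, hv.1, Field.absoluteGaloisGroup.smul_def, map_intCast]
  have h6 : kC6 (σ • a) (σ • b) = kC6 a b := by
    rw [← smul_kC6, hv.2, Field.absoluteGaloisGroup.smul_def, map_intCast]
  obtain ⟨hDg, -⟩ := klein_comp_Gm a b (σ • a) (σ • b) hD h4 h6
  obtain ⟨g, hg⟩ : ∃ g : Matrix (Fin 2) (Fin 2) (AlgebraicClosure ℚ), g = Gm a b (σ • a) (σ • b) := ⟨_, rfl⟩
  rw [← hg] at hDg ⊢
  have hdet : g.det ≠ 0 := by rw [hg]; exact Gm_det_ne a b _ _ hD hDσ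
  -- the golden ratio
  obtain ⟨η, hη⟩ := exists_phi5_root
  have fixH : Field.absoluteGaloisGroup.toAlgEquiv ℚ σ η = η := phi5_root_fixed σ h5 hη
  obtain ⟨φ, hφ⟩ : ∃ φ : (AlgebraicClosure ℚ), φ = -(η ^ 2 + η ^ 3) := ⟨_, rfl⟩
  have hσφ : σ • φ = φ := by
    rw [Field.absoluteGaloisGroup.smul_def, hφ]; simp only [map_neg, map_add, map_pow, fixH]
  have hφ0 : φ ≠ 0 := by
    intro h
    have hprod := g1_unit η hη
    rw [← hφ, h, zero_mul] at hprod; norm_num at hprod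
  have hDφ : kD φ 1 = 0 := by rw [hφ]; exact g1_vertex η hη
  -- KEY: on a σ-fixed vertex vector, `σ(g)` and `g` agree projectively
  have key : ∀ x y : (AlgebraicClosure ℚ), (x, y) ≠ (0, 0) → σ • x = x → σ • y = y → kD x y = 0 →
      ∃ t : (AlgebraicClosure ℚ), (ap (gal σ g) x y).1 = t * (ap g x y).1 ∧
        (ap (gal σ g) x y).2 = t * (ap g x y).2 := by
    intro x y h0 hx hy hDxy
    obtain ⟨p, hp⟩ : ∃ p : (AlgebraicClosure ℚ), p = (ap g x y).1 := ⟨_, rfl⟩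
    obtain ⟨q, hq⟩ : ∃ q : (AlgebraicClosure ℚ), q = (ap g x y).2 := ⟨_, rfl⟩
    have hpq : ap g x y = (p, q) := by rw [hp, hq]
    have hDpq : kD p q = 0 := by
      have := hDg x y; rw [hpq, hDxy, mul_zero] at this; exact this
    have hpq0 : (p, q) ≠ (0, 0) := by
      intro h
      exact eigen_ne_zero g hdet x y 0 h0 (by rw [hpq, h, zero_mul, zero_mul]) rfl
    have hgal1 : (ap (gal σ g) x y).1 = σ • p := by
      have := congrArg Prod.fst (ap_gal σ g x y); rw [hx, hy] at this; rw [this, hp]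
    have hgal2 : (ap (gal σ g) x y).2 = σ • q := by
      have := congrArg Prod.snd (ap_gal σ g x y); rw [hx, hy] at this; rw [this, hq]
    rw [hgal1, hgal2, hpq]
    dsimp only
    by_cases hq0 : q = 0
    · -- the vertex `(1 : 0)`
      have hp0 : p ≠ 0 := by rintro rfl; exact hpq0 (by rw [hq0])
      refine ⟨σ • p / p, ?_, ?_⟩
      · rw [div_mul_cancel₀ _ hp0]
      · rw [hq0, smul_zero, mul_zero]
    · -- normalise to `(p/q : 1)`, a `σ`-fixed vertex by G1
      have hD0 : kD (p / q) 1 = 0 := by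
        have := kD_smul q (p / q) 1
        rw [mul_div_cancel₀ _ hq0, mul_one, hDpq] at this
        exact (mul_eq_zero.mp this.symm).resolve_left (pow_ne_zero _ hq0)
      have hfix : σ • (p / q) = p / q := vertex_fixed σ h5 _ hD0
      refine ⟨σ • q / q, ?_, ?_⟩
      · have hp' : p = p / q * q := (div_mul_cancel₀ p hq0).symm
        calc σ • p = σ • (p / q * q) := by rw [← hp']
          _ = p / q * σ • q := by rw [smul_mul', hfix]
          _ = σ • q / q * p := by field_simp
      · rw [div_mul_cancel₀ _ hq0]
  have hσ1 : σ • (1 : (AlgebraicClosure ℚ)) = 1 := smul_one σ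
  have hσ0 : σ • (0 : (AlgebraicClosure ℚ)) = 0 := smul_zero σ
  obtain ⟨t₁, e1, e2⟩ := key 1 0 (by simp) hσ1 hσ0 (by simp [kD])
  obtain ⟨t₂, e3, e4⟩ := key 0 1 (by simp) hσ0 hσ1 (by simp [kD])
  obtain ⟨t₃, e5, e6⟩ := key φ 1 (by simp) hσφ hσ1 hDφ
  simp only [ap, mul_one, mul_zero, add_zero, zero_add] at e1 e2 e3 e4 e5 e6
  -- e1 : G00 = t₁ g00, e2 : G10 = t₁ g10, e3 : G01 = t₂ g01, e4 : G11 = t₂ g11,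
  -- e5 : G00 φ + G01 = t₃ (g00 φ + g01), e6 : G10 φ + G11 = t₃ (g10 φ + g11)
  have hu : g 0 0 * ((t₁ - t₃) * φ) + g 0 1 * (t₂ - t₃) = 0 := by
    linear_combination e5 - φ * e1 - e3
  have hw : g 1 0 * ((t₁ - t₃) * φ) + g 1 1 * (t₂ - t₃) = 0 := by
    linear_combination e6 - φ * e2 - e4
  have hdet' : g 0 0 * g 1 1 - g 0 1 * g 1 0 ≠ 0 := by rwa [Matrix.det_fin_two] at hdet
  have h23 : t₂ = t₃ := by
    have : (g 0 0 * g 1 1 - g 0 1 * g 1 0) * (t₂ - t₃) = 0 := by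
      linear_combination (g 0 0) * hw - (g 1 0) * hu
    linear_combination (mul_eq_zero.mp this).resolve_left hdet'
  have h13 : t₁ = t₃ := by
    have : (g 0 0 * g 1 1 - g 0 1 * g 1 0) * ((t₁ - t₃) * φ) = 0 := by
      linear_combination (g 1 1) * hu - (g 0 1) * hw
    have := (mul_eq_zero.mp ((mul_eq_zero.mp this).resolve_left hdet')).resolve_right hφ0
    linear_combination this
  refine ⟨t₃, ?_, ?_⟩
  · intro ht
    have hG : (gal σ g).det = 0 := by
      rw [Matrix.det_fin_two, e1, e2, e3, e4, h13, h23, ht]; ring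
    rw [gal_det, Field.absoluteGaloisGroup.smul_def] at hG
    have := (Field.absoluteGaloisGroup.toAlgEquiv ℚ σ).injective.ne hdet
    rw [map_zero] at this
    exact this hG
  · ext i j
    fin_cases i <;> fin_cases j <;> simp [Matrix.smul_apply, e1, e2, e3, e4, h13, h23]

/-- **H8 (PROVED from K1 + K2 by induction): powers along one Galois element.**  For `σ ⊇ μ₅`
and a torsor point `v` of a RATIONAL `(c₄, c₆)`: `g_{σ^k} = μ_k · g_σ^k` (`μ_k ≠ 0`), with
`μ_{k+1} = σ(μ_k)·λ^k`.  Used at `k = P` (with H7′: finite projective order), `k = m` (even case)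
and `k = N` (odd case) of the assembly. [folklore] -/
private theorem Gm_galois_pow (c₄ c₆ : ℤ) (hc : (c₄ : (AlgebraicClosure ℚ)) ^ 3 ≠ (c₆ : (AlgebraicClosure ℚ)) ^ 2) (a b : (AlgebraicClosure ℚ))
    (hv : kC4 a b = c₄ ∧ kC6 a b = c₆) (σ : (Field.absoluteGaloisGroup ℚ)) (h5 : ∀ z : (AlgebraicClosure ℚ), z ^ 5 = 1 → σ • z = z) (k : ℕ) :
    ∃ μ : (AlgebraicClosure ℚ), μ ≠ 0 ∧
      Gm a b ((σ ^ k) • a) ((σ ^ k) • b) = μ • (Gm a b (σ • a) (σ • b)) ^ k := by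
  have hne : kC4 a b ^ 3 ≠ kC6 a b ^ 2 := by rw [hv.1, hv.2]; exact hc
  have hD : kD a b ≠ 0 := kD_ne_zero_of_ne a b hne
  obtain ⟨l, hl0, hl⟩ := gal_Gm_eq_smul c₄ c₆ hc a b hv σ h5
  induction k with
  | zero =>
    exact ⟨1, one_ne_zero, by rw [pow_zero, one_smul, one_smul, pow_zero, one_smul, Gm_self a b hD]⟩
  | succ k ih =>
    obtain ⟨μ, hμ0, hμ⟩ := ih
    have hσμ : σ • μ ≠ 0 := by
      rw [Field.absoluteGaloisGroup.smul_def]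
      have := (Field.absoluteGaloisGroup.toAlgEquiv ℚ σ).injective.ne hμ0
      rwa [map_zero] at this
    refine ⟨σ • μ * l ^ k, mul_ne_zero hσμ (pow_ne_zero _ hl0), ?_⟩
    rw [pow_succ' σ k, mul_smul, mul_smul, Gm_cocycle σ a b _ _ hD, hμ, gal_smul, map_pow, hl,
      smul_pow, smul_smul, smul_mul_assoc, ← pow_succ]

/-! ## §5 ASSEMBLY (g10) — KERNEL-CHECKED, all inputs proved above (T1, H1, G1, G2, H6, H7′, H8, INV, H-ROOT) -/

/-- `core1728At_of_icosahedral_descent` — step of Klein's icosahedral descent for the `3`–`5` switch (see the module docstring). [folklore] -/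
private theorem core1728At_of_icosahedral_descent (c₄ c₆ : ℤ) (hc : c₄ ^ 3 ≠ c₆ ^ 2) (h6 : c₆ ≠ 0) :
    Core1728At c₄ c₆ := by
  classical
  have hc' : (c₄ : (AlgebraicClosure ℚ)) ^ 3 ≠ ((c₆ : ℤ) : (AlgebraicClosure ℚ)) ^ 2 := by exact_mod_cast hc
  obtain ⟨a, b, ha, hb⟩ := exists_torsorPoint (c₄ : (AlgebraicClosure ℚ)) ((c₆ : ℤ) : (AlgebraicClosure ℚ)) hc'
  obtain ⟨σ, h20, hs3⟩ := exists_sigma_fix20_negSqrt3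
  have h5 : ∀ z : (AlgebraicClosure ℚ), z ^ 5 = 1 → σ • z = z := fun z hz =>
    h20 z (by rw [show (20 : ℕ) = 5 * 4 from rfl, pow_mul, hz, one_pow])
  have h4 : ∀ z : (AlgebraicClosure ℚ), z ^ 4 = 1 → σ • z = z := fun z hz =>
    h20 z (by rw [show (20 : ℕ) = 4 * 5 from rfl, pow_mul, hz, one_pow])
  have hne : kC4 a b ^ 3 ≠ kC6 a b ^ 2 := by rw [ha, hb]; exact hc'
  have hD : kD a b ≠ 0 := kD_ne_zero_of_ne a b hne
  have h6' : kC6 a b ≠ 0 := by rw [hb]; exact_mod_cast h6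
  -- every `σ^k • v` is a torsor point of the same `(c₄, c₆)`
  have htor : ∀ k : ℕ, kC4 ((σ ^ k) • a) ((σ ^ k) • b) = kC4 a b ∧
      kC6 ((σ ^ k) • a) ((σ ^ k) • b) = kC6 a b := by
    intro k
    refine ⟨?_, ?_⟩
    · rw [← smul_kC4, ha, Field.absoluteGaloisGroup.smul_def, map_intCast]
    · rw [← smul_kC6, hb, Field.absoluteGaloisGroup.smul_def, map_intCast]
  have hDk : ∀ k : ℕ, kD ((σ ^ k) • a) ((σ ^ k) • b) ≠ 0 := fun k =>
    kD_ne_zero_of_ne _ _ (by rw [(htor k).1, (htor k).2]; exact hne)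
  -- the transition matrix `g = g_σ` and its finite projective order `N`
  have htor1 := htor 1
  simp only [pow_one] at htor1
  have hD1 : kD (σ • a) (σ • b) ≠ 0 := by simpa using hDk 1
  obtain ⟨hgD, -⟩ := klein_comp_Gm a b (σ • a) (σ • b) hD htor1.1 htor1.2
  have hgdet := Gm_det_ne a b (σ • a) (σ • b) hD hD1
  obtain ⟨g, hg_def⟩ : ∃ g, g = Gm a b (σ • a) (σ • b) := ⟨_, rfl⟩
  rw [← hg_def] at hgD hgdet
  -- H7′ + H8: `g_σ` has finite projective order (`σ^P` fixes `a` and `b`, so `g^P ∝ g_{σ^P} = 1`)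
  obtain ⟨Pa, hPa0, hPa⟩ := exists_pos_pow_smul_eq σ a
  obtain ⟨Pb, hPb0, hPb⟩ := exists_pos_pow_smul_eq σ b
  have hPa' : (σ ^ (Pa * Pb)) • a = a := by rw [pow_mul]; exact smul_fix_pow _ hPa Pb
  have hPb' : (σ ^ (Pa * Pb)) • b = b := by
    rw [mul_comm, pow_mul]; exact smul_fix_pow _ hPb Pa
  have hP : ∃ n : ℕ, 0 < n ∧ ∃ μ : (AlgebraicClosure ℚ), g ^ n = μ • (1 : Matrix (Fin 2) (Fin 2) (AlgebraicClosure ℚ)) := by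
    obtain ⟨μP, hμP0, hGP⟩ := Gm_galois_pow c₄ c₆ hc' a b ⟨ha, hb⟩ σ h5 (Pa * Pb)
    rw [← hg_def, hPa', hPb', Gm_self a b hD] at hGP
    refine ⟨Pa * Pb, Nat.mul_pos hPa0 hPb0, μP⁻¹, ?_⟩
    rw [hGP, smul_smul, inv_mul_cancel₀ hμP0, one_smul]
  obtain ⟨N, hN_def⟩ : ∃ N, N = Nat.find hP := ⟨_, rfl⟩
  have hspec : 0 < N ∧ ∃ μ : (AlgebraicClosure ℚ), g ^ N = μ • (1 : Matrix (Fin 2) (Fin 2) (AlgebraicClosure ℚ)) := by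
    rw [hN_def]; exact Nat.find_spec hP
  obtain ⟨hNpos, μN, hμN⟩ := hspec
  have hmin : ∀ m, m < N → ¬ (0 < m ∧ ∃ μ : (AlgebraicClosure ℚ), g ^ m = μ • (1 : Matrix (Fin 2) (Fin 2) (AlgebraicClosure ℚ))) :=
    fun m hm => Nat.find_min hP (by rw [← hN_def]; exact hm)
  rcases Nat.even_or_odd N with ⟨m, hm⟩ | hodd
  · /- EVEN projective order `N = m + m`: `[g_{σ^m}]` is a non-scalar involution; an eigenvector of
       `g_σ` is an edge midpoint (INV), `σ`-fixed (G2), and `σ` fixes its good root. -/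
    have hm0 : 0 < m := by omega
    have hmN : m < N := by omega
    have hns_gm : ∀ l : (AlgebraicClosure ℚ), g ^ m ≠ l • 1 := fun l h => hmin m hmN ⟨hm0, l, h⟩
    obtain ⟨μm, hμm0, hGm⟩ := Gm_galois_pow c₄ c₆ hc' a b ⟨ha, hb⟩ σ h5 m
    rw [← hg_def] at hGm
    -- the involution property and non-scalarity of `g_{σ^m}`
    have hsq : Gm a b ((σ ^ m) • a) ((σ ^ m) • b) * Gm a b ((σ ^ m) • a) ((σ ^ m) • b) =
        (μm ^ 2 * μN) • (1 : Matrix (Fin 2) (Fin 2) (AlgebraicClosure ℚ)) := by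
      rw [hGm, Matrix.smul_mul, Matrix.mul_smul, ← pow_add, ← hm, hμN, smul_smul, smul_smul]
      congr 1
      ring
    have hns : ∀ l : (AlgebraicClosure ℚ), Gm a b ((σ ^ m) • a) ((σ ^ m) • b) ≠ l • 1 := by
      intro l h
      apply hns_gm (μm⁻¹ * l)
      rw [hGm] at h
      calc g ^ m = μm⁻¹ • (μm • g ^ m) := by rw [smul_smul, inv_mul_cancel₀ hμm0, one_smul]
        _ = (μm⁻¹ * l) • 1 := by rw [h, smul_smul]
    -- an eigenvector of `g_σ`; it is one of `g_{σ^m} = μm • g^m`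
    obtain ⟨x₀, y₀, ν, h0, heig⟩ := exists_eigen g
    have heig_m : ap (Gm a b ((σ ^ m) • a) ((σ ^ m) • b)) x₀ y₀ = (μm * ν ^ m * x₀, μm * ν ^ m * y₀) := by
      rw [hGm, ap_smul, ap_pow_of_eigen g x₀ y₀ ν heig m]
      simp only [mul_assoc]
    obtain ⟨he6, he4⟩ := edge_of_eigenvector a b ((σ ^ m) • a) ((σ ^ m) • b) hne (htor m).1 (htor m).2
      _ hsq hns x₀ y₀ (μm * ν ^ m) h0 heig_m
    -- normalise the eigenvector to `(x : 1)`
    have hy₀ : y₀ ≠ 0 := by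
      rintro rfl
      have : kC6 x₀ (0 : (AlgebraicClosure ℚ)) = -x₀ ^ 30 := by simp [kC6]
      rw [this, neg_eq_zero] at he6
      have hx : x₀ = 0 := pow_eq_zero_iff (by norm_num) |>.mp he6
      exact h0 (by rw [hx])
    obtain ⟨x, hx_def⟩ : ∃ x : (AlgebraicClosure ℚ), x = x₀ / y₀ := ⟨_, rfl⟩
    have hxy : y₀ * x = x₀ := by rw [hx_def]; field_simp
    have he6x : kC6 x 1 = 0 := by
      have := kC6_smul y₀ x 1
      rw [hxy, mul_one, he6] at this
      rcases mul_eq_zero.mp this.symm with h | h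
      · exact absurd (pow_eq_zero_iff (by norm_num) |>.mp h) hy₀
      · exact h
    have he4x : kC4 x 1 ≠ 0 := by
      intro h
      have := kC4_smul y₀ x 1
      rw [hxy, mul_one, h, mul_zero] at this
      exact he4 this
    have heigx : ap g x 1 = (ν * x, ν) := by
      have h1 := congrArg Prod.fst heig
      have h2 := congrArg Prod.snd heig
      simp only [ap] at h1 h2 ⊢
      rw [← hxy] at h1 h2
      rw [Prod.mk.injEq]
      constructor
      · have : y₀ * (g 0 0 * x + g 0 1 * 1) = y₀ * (ν * x) := by linear_combination h1
        exact mul_left_cancel₀ hy₀ this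
      · have : y₀ * (g 1 0 * x + g 1 1 * 1) = y₀ * ν := by linear_combination h2
        exact mul_left_cancel₀ hy₀ this
    -- `σ` fixes `x` (G2) and hence the good root `t_x(v)`
    have hσx : σ • x = x := edge_fixed σ h20 x he6x
    have hnd : (1 : (AlgebraicClosure ℚ)) * a - x * b ≠ 0 := edge_nondeg a b x 1 he6x he4x h6'
    have hnd' : (1 : (AlgebraicClosure ℚ)) * (σ • a) - x * (σ • b) ≠ 0 :=
      edge_nondeg (σ • a) (σ • b) x 1 he6x he4x (by rw [htor1.2]; exact h6')
    have hfix : σ • tE a b x 1 = tE a b x 1 := by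
      rw [smul_tE, hσx, smul_one]
      rw [hg_def] at heigx
      exact tE_eq_of_eigen a b (σ • a) (σ • b) hD x ν heigx hnd hnd'
    obtain ⟨hC6, hC4⟩ := goodRoot_tE a b x 1 he6x he4x hD hnd
    rw [ha, hb] at hC6 hC4
    exact ⟨σ, tE a b x 1, hs3, h4, hC6, hC4, hfix⟩
  · /- ODD projective order: `τ := σ^N` still inverts `√−3`, and `M_{τ v} ∝ M_v`, so `τ` fixes the
       good root `t_i(v)` attached to the edge midpoint `i`. -/
    obtain ⟨τ, hτ⟩ : ∃ τ : (Field.absoluteGaloisGroup ℚ), τ = σ ^ N := ⟨_, rfl⟩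
    obtain ⟨μ', hμ'0, hGN⟩ := Gm_galois_pow c₄ c₆ hc' a b ⟨ha, hb⟩ σ h5 N
    rw [← hg_def, ← hτ] at hGN
    have hscal : Gm a b (τ • a) (τ • b) = (μ' * μN) • (1 : Matrix (Fin 2) (Fin 2) (AlgebraicClosure ℚ)) := by
      rw [hGN, hμN, smul_smul]
    have hDτ : kD (τ • a) (τ • b) ≠ 0 := by rw [hτ]; exact hDk N
    have hl0 : μ' * μN ≠ 0 := by
      intro h
      exact Gm_det_ne a b (τ • a) (τ • b) hD hDτ
        (by rw [hscal, h, zero_smul]; exact Matrix.det_zero)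
    have hMv : Mv (τ • a) (τ • b) = (μ' * μN) • Mv a b := Mv_eq_smul_of_Gm a b _ _ _ hD hscal
    obtain ⟨i, hi⟩ := IsAlgClosed.exists_pow_nat_eq (-1 : (AlgebraicClosure ℚ)) (n := 2) (by norm_num)
    have hi20 : i ^ 20 = 1 := by rw [show (20 : ℕ) = 2 * 10 from rfl, pow_mul, hi]; norm_num
    have hτi : τ • i = i := by rw [hτ]; exact smul_fix_pow σ (h20 i hi20) N
    have hτ4 : ∀ z : (AlgebraicClosure ℚ), z ^ 4 = 1 → τ • z = z := fun z hz => by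
      rw [hτ]; exact smul_fix_pow σ (h4 z hz) N
    have hτ3 : ∀ s : (AlgebraicClosure ℚ), s ^ 2 = -3 → τ • s = -s := fun s hs => by
      rw [hτ]; exact smul_neg_pow_odd σ (hs3 s hs) hodd
    have hfix : τ • tE a b i 1 = tE a b i 1 := by
      rw [smul_tE, hτi, smul_one]
      exact tE_eq_of_Mv_smul a b (τ • a) (τ • b) _ hl0 hMv i 1
    have he6 : kC6 i (1 : (AlgebraicClosure ℚ)) = 0 := kC6_I i hi
    have he4 : kC4 i (1 : (AlgebraicClosure ℚ)) ≠ 0 := kC4_I_ne i hi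
    have hnd : (1 : (AlgebraicClosure ℚ)) * a - i * b ≠ 0 := edge_nondeg a b i 1 he6 he4 h6'
    obtain ⟨hC6, hC4⟩ := goodRoot_tE a b i 1 he6 he4 hD hnd
    rw [ha, hb] at hC6 hC4
    exact ⟨τ, tE a b i 1, hτ3, hτ4, hC6, hC4, hfix⟩

/-- **`Core1728` PROVED** by Klein's icosahedral descent: transition matrices between torsor points preserve
`kD` (up to `μ₅`) and `kC4` exactly, have finite projective order, and a non-scalar involution among them has
an eigenvector at an EDGE MIDPOINT (`kC6 = 0 ≠ kC4`), which is then a `τ`-fixed good root. [cite: ConradDiamondTaylor1999, proof of Thm. 7.1.2 (p. 556)] -/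
theorem core1728_of_icosahedral_descent : Core1728 := by
  rw [core1728_iff]
  intro c₄ c₆ hc h6
  exact core1728At_of_icosahedral_descent c₄ c₆ hc h6

/-- **`Core1728` DISCHARGED** under the obligation-graph name `<Name>_holds` (= `core1728_of_icosahedral_descent`);
downstream (`CDTThreeFiveSwitchProofs`) consumes this name. [cite: ConradDiamondTaylor1999, proof of Thm. 7.1.2 (p. 556)] -/
theorem Core1728_holds : Core1728 := core1728_of_icosahedral_descent

end Galois

end Literature.NumberTheory.Automorphic.CDTThreeFiveSwitch.Descent
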